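import Literature.NumberTheory.Sieve.FriedlanderIwaniecPrimesJacobiTwistedSymmetry
import Mathlib.Analysis.SpecialFunctions.Integrals.Basic
import Mathlib.Analysis.SumIntegralComparisons
import HarnessLib

/-!
# Friedlander–Iwaniec, *The polynomial `X² + Y⁴` captures its primes*, §11: Proposition 11.1

Family `parity`, statement parity.S17 (`setOf_prime_sq_add_pow_four_infinite`). Source: J. Friedlander,
H. Iwaniec, Ann. of Math. (2) 148 (1998), 945–1040 [FriedlanderIwaniecAnnals1998], §11,
Proposition 11.1 ((11.14)) and the end of the proof of (11.19), pp. 988–991: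
"Now we are ready to prove (11.19) in its general form. We write `(11.25)` where `e` stands for the
common divisor of `a` and `d`. … Hence, by Cauchy's inequality, for any `e^α f^{-α}` we have
`W(D) ≤ ∑_e ∑_f τ(e) e^α f^{-α} ∑_r ∑_s |…|²`, where `ef` is restricted by `d`. … We choose
`α = (1 - ε)/2` so the series for `f` converges giving … This completes the proof of (11.19)."

Eighth file of the §§11–14 unit; it closes §11. PROVED here:

* the removal step ("W8"): regrouping of the inner sum `Z(r, s)` by `e = (s, d)` (= `(a, d)` for
  `a = s r̄`), `jtInner_eq_sum_pull`, with the vectors `γ^{(e)} = jtPull γ e` (unit-supported at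
  level `(D/e, 2D/e]`, `∑_e ‖γ^{(e)}‖² ≤ ‖γ‖²`, `sum_jtNormSq_jtPull_le`) and their dilations
  `jtDilate` (`(f t) r̄ ≡ f (t r̄)`, `jtInner_mul_eq_jtInner_jtDilate`, norm `≤`); the weighted
  Cauchy inequality and the exchange `jtW_le_sum_pairs_ef`; the reindexing `s = [e,f] t`
  (`sum_filter_dvd_dvd_eq_sum_lcm`); the bound for each `(e, f)`-piece by (11.24)
  (`exists_piece_le`, `exists_ef_piece_le`: the `t`-range `(S/ℓ, 2S/ℓ]` is covered by two dyadic
  ranges, or is the single slice `t = 1`, bounded trivially by `sum_norm_jtInner_sq_le_trivial`);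
  the `f`-series `∑_f (e,f) f^{-1-κ} ≤ τ(e)(1 + 1/κ)` (`sum_gcd_rpow_mul_rpow_le`, from
  `∑_{m ≤ N} m^{-1-κ} ≤ 1 + 1/κ`) and the `e`-factors `τ(e)² e^{-κ} ≤ C` ; the pure algebra of the
  weights `e^α f^{-α}` against the bound of (11.24) (`ef_weights_le`);
* **`exists_jtW_le_removed` — (11.19)**: for `0 < ε ≤ 1/4`,
  `W(D) ≤ C {RS/√D + (S R^{3/4} + R S^{3/4} + D√(RS)) (4DRS)^ε} ‖γ‖²` (`D, R, S ≥ 1`, all `γ`);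
* **`exists_jtV_le` — Proposition 11.1**: for every `ε > 0` there is `C` with, for `D, R, S ≥ 1`
  and all `α_{rs}`,
  `V(D) ≤ C {D^{-1/2} RS + (D√(RS) + R S^{3/4} + S R^{3/4}) (RS)^ε} ∑ |α_{rs}|²`
  (duality from (11.19) when `D ≤ 4RS`, so that `(4DRS)^{ε'} ≤ 16 (RS)^ε`; for `D > 4RS` the
  direct bound `jtV_le_of_large_level`, in line with "if `D > RS` the estimate is trivial").

Deviations from the printed argument (none affects the statement of Proposition 11.1): the
support condition is `(a, d) = 1` rather than `(a, d') = 1` (see `…JacobiTwistedSymmetry`); the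
weights in Cauchy's inequality are `∑_{f ≤ 2D, f ∣ s} f^{-α}` against `∑_{e ≤ 2D, e ∣ s} e^α |Z_e|²`
exactly as printed, the factor `τ(e)` of the source appearing instead through
`∑_f (e, f) f^{-1-κ} ≤ τ(e)(1 + 1/κ)`; the `ε`-bookkeeping uses `α = (1-ε)/2` with `ε ≤ 1/4`.

## References

* J. Friedlander, H. Iwaniec, Ann. of Math. (2) 148 (1998), 945–1040, §11, Proposition 11.1,
  (11.14), (11.19), (11.25). [FriedlanderIwaniecAnnals1998]

## Tree / Mathlib

Tree: `exists_jtW_le_unitSupported` ((11.24)), `jtV_le_of_forall_jtW_le`, `jtV_le_of_large_level`,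
`IsUnitSupported`, `norm_sum_sq_le_card_mul` (`…JacobiTwistedSymmetry`); `jtW_eq_sum_congrSol`,
`congrSol` API, `jtChar_mul_jtChar` (`…JacobiTwistedForms`, `…JacobiTwistedDualBound`);
`card_le_of_forall_dvd_sub_int` (`…JacobiTwistedPairBound`); `exists_sigma_zero_le_mul_rpow`
(`DivisorBound`). Mathlib: `AntitoneOn.sum_le_integral_Ico`, `integral_rpow`,
`ZMod.coprime_mod_iff_coprime`, `Nat.coprime_div_gcd_div_gcd`, `Finset.sum_nbij'`.
-/

noncomputable section

open Finset Real Complex MeasureTheory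
open scoped FourierTransform ContDiff ComplexConjugate NumberTheorySymbols ArithmeticFunction.sigma Nat

namespace Literature.NumberTheory.Sieve.FriedlanderIwaniecPrimes

open LargeSieve (e)


/-! ### W8: arithmetic of the class `s r̄` under scaling and dilation -/

/-- **Pulling out a common factor:** `congrSol (e d₁) r (e s₁) = e · congrSol d₁ r s₁` for `(r, e d₁) = 1`
(the class `a = s r̄ (mod d)` with `e = (s, d)` is `e a₁`, `a₁ = s₁ r̄ (mod d₁)`). [folklore] -/
theorem congrSol_mul_mul {e d₁ r : ℕ} (he : 0 < e) (hd₁ : 0 < d₁) (hr : r.Coprime (e * d₁)) (s₁ : ℕ) :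
    congrSol (e * d₁) r (e * s₁) = e * congrSol d₁ r s₁ := by
  have hd : 0 < e * d₁ := Nat.mul_pos he hd₁
  have hr₁ : r.Coprime d₁ := hr.coprime_dvd_right (dvd_mul_left d₁ e)
  symm
  have hlt : e * congrSol d₁ r s₁ < e * d₁ := Nat.mul_lt_mul_of_pos_left (congrSol_lt hd₁ r s₁) he
  refine (dvd_sub_mul_iff_eq_congrSol hd hr (e * s₁) hlt).mp ?_
  have h := dvd_sub_congrSol_mul hd₁ hr₁ s₁
  have he' : ((e * s₁ : ℕ) : ℤ) - ((e * congrSol d₁ r s₁ : ℕ) : ℤ) * r =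
      (e : ℤ) * ((s₁ : ℤ) - (congrSol d₁ r s₁ : ℤ) * r) := by push_cast; ring
  rw [he']
  exact mul_dvd_mul_left _ h

/-- **Dilation:** `congrSol d r (f t) = (f · congrSol d r t) mod d` for `(r, d) = 1`. [folklore] -/
theorem congrSol_mul_left {d r : ℕ} (hd : 0 < d) (hr : r.Coprime d) (f t : ℕ) :
    congrSol d r (f * t) = (f * congrSol d r t) % d := by
  symm
  refine (dvd_sub_mul_iff_eq_congrSol hd hr (f * t) (Nat.mod_lt _ hd)).mp ?_
  have h := dvd_sub_congrSol_mul hd hr t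
  have h1 : (d : ℤ) ∣ (f : ℤ) * ((t : ℤ) - (congrSol d r t : ℤ) * r) := h.mul_left _
  have h2 : (d : ℤ) ∣ ((f * congrSol d r t : ℕ) : ℤ) - ((f * congrSol d r t % d : ℕ) : ℤ) := by
    rw [← Nat.cast_sub (Nat.mod_le _ _), Int.natCast_dvd_natCast]
    exact Nat.dvd_sub_mod _
  have h3 := dvd_add h1 (h2.mul_right (r : ℤ))
  have he : (f : ℤ) * ((t : ℤ) - (congrSol d r t : ℤ) * r) +
      (((f * congrSol d r t : ℕ) : ℤ) - ((f * congrSol d r t % d : ℕ) : ℤ)) * r =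
      ((f * t : ℕ) : ℤ) - ((f * congrSol d r t % d : ℕ) : ℤ) * r := by push_cast; ring
  rwa [he] at h3




/-! ### W8: the vectors `γ^{(e)}` and their dilations -/

/-- `γ^{(e)}_{d₁}(a₁) = γ_{e d₁}(e a₁)` on the unit classes `(a₁, d₁) = 1` (and `0` elsewhere): the
part of `γ` on the classes `a (mod d)` with `(a, d) = e`, transported to level `d₁ = d/e`.
[cite: FriedlanderIwaniecAnnals1998, §11, end of the proof of (11.19)] -/
def jtPull (γ : ℕ → ℕ → ℂ) (e : ℕ) (d₁ a₁ : ℕ) : ℂ :=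
  if a₁.Coprime d₁ then γ (e * d₁) (e * a₁) else 0

/-- Unfolding `jtPull`. [folklore] -/
theorem jtPull_def (γ : ℕ → ℕ → ℂ) (e d₁ a₁ : ℕ) :
    jtPull γ e d₁ a₁ = if a₁.Coprime d₁ then γ (e * d₁) (e * a₁) else 0 := rfl

/-- The dilation `b ↦ γ'_{d₁}(f b mod d₁)`. [folklore] -/
def jtDilate (γ' : ℕ → ℕ → ℂ) (f : ℕ) (d₁ b : ℕ) : ℂ := γ' d₁ (f * b % d₁)

/-- Unfolding `jtDilate`. [folklore] -/
theorem jtDilate_def (γ' : ℕ → ℕ → ℂ) (f d₁ b : ℕ) : jtDilate γ' f d₁ b = γ' d₁ (f * b % d₁) := rfl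

/-- `γ^{(e)}` is supported on the unit classes. [folklore] -/
theorem isUnitSupported_jtPull (D₁ D₂ : ℕ) (γ : ℕ → ℕ → ℂ) (e : ℕ) :
    IsUnitSupported D₁ D₂ (jtPull γ e) := fun d _ a _ ha => by rw [jtPull_def, if_neg ha]

/-- The dilation of a unit-supported vector is unit-supported. [folklore] -/
theorem isUnitSupported_jtDilate {D₁ D₂ : ℕ} {γ' : ℕ → ℕ → ℂ} (h : IsUnitSupported D₁ D₂ γ') (f : ℕ) :
    IsUnitSupported D₁ D₂ (jtDilate γ' f) := by
  intro d hd b hb hbc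
  have hd0 : 0 < d := by rw [mem_Ioc] at hd; omega
  rw [jtDilate_def]
  refine h d hd _ (Nat.mod_lt _ hd0) fun hc => hbc ?_
  -- `(f b mod d, d) = 1 ⇒ (b, d) = 1`
  have : (f * b).Coprime d := (ZMod.coprime_mod_iff_coprime (f * b) d).mp hc
  exact Nat.Coprime.coprime_mul_left this




/-- **`‖dilation‖ ≤ ‖γ'‖`** for unit-supported `γ'` (a bijection of the classes if `(f, d) = 1`, and
identically zero otherwise). [folklore] -/
theorem jtNormSq_jtDilate_le {D₁ D₂ : ℕ} {γ' : ℕ → ℕ → ℂ} (h : IsUnitSupported D₁ D₂ γ') (f : ℕ) :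
    jtNormSq D₁ D₂ (jtDilate γ' f) ≤ jtNormSq D₁ D₂ γ' := by
  rw [jtNormSq_def, jtNormSq_def]
  refine sum_le_sum fun d hd => ?_
  have hd0 : 0 < d := by rw [mem_Ioc] at hd; omega
  by_cases hf : f.Coprime d
  · -- bijection `b ↦ f b mod d`
    refine le_of_eq ?_
    simp only [jtDilate_def]
    refine sum_nbij' (fun b => f * b % d) (fun a => congrSol d f a) ?_ ?_ ?_ ?_ ?_
    · intro b _; exact mem_range.mpr (Nat.mod_lt _ hd0)
    · intro a _; exact mem_range.mpr (congrSol_lt hd0 f a)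
    · intro b hb
      rw [mem_range] at hb
      -- `congrSol d f (f b % d) = b`: the class `c` with `f b ≡ c f` is `b`
      symm
      refine (dvd_sub_mul_iff_eq_congrSol hd0 hf (f * b % d) hb).mp ?_
      have h1 : (d : ℤ) ∣ ((f * b % d : ℕ) : ℤ) - ((f * b : ℕ) : ℤ) := by
        rw [← neg_sub, dvd_neg, ← Nat.cast_sub (Nat.mod_le _ _), Int.natCast_dvd_natCast]
        exact Nat.dvd_sub_mod _
      have he : ((f * b % d : ℕ) : ℤ) - (b : ℤ) * f = ((f * b % d : ℕ) : ℤ) - ((f * b : ℕ) : ℤ) := by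
        push_cast; ring
      rwa [he]
    · intro a ha
      rw [mem_range] at ha
      -- `f · (a f̄) ≡ a (mod d)`
      have h1 := dvd_sub_congrSol_mul hd0 hf a
      have hm : f * congrSol d f a ≡ a [MOD d] := by
        refine Nat.modEq_iff_dvd.mpr ?_
        have he : (a : ℤ) - ((f * congrSol d f a : ℕ) : ℤ) = (a : ℤ) - (congrSol d f a : ℤ) * f := by
          push_cast; ring
        rw [he]; exact h1
      have h3 : f * congrSol d f a % d = a % d := hm
      rw [Nat.mod_eq_of_lt ha] at h3
      exact h3
    · intro b _; rfl
  · -- every class `f b` is a non-unit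
    refine le_trans (le_of_eq (sum_eq_zero fun b hb => ?_)) (sum_nonneg fun _ _ => by positivity)
    rw [jtDilate_def, h d hd _ (Nat.mod_lt _ hd0), norm_zero, zero_pow two_ne_zero]
    intro hc
    exact hf (Nat.Coprime.coprime_mul_right ((ZMod.coprime_mod_iff_coprime (f * b) d).mp hc))




/-- **`∑_e ‖γ^{(e)}‖² ≤ ‖γ‖²`**: the map `(e, d₁, a₁) ↦ (e d₁, e a₁)` is injective on the triples with
`(a₁, d₁) = 1` (then `e = (e a₁, e d₁)`), and `D/e < d₁ ≤ 2D/e` gives `D < e d₁ ≤ 2D`. [folklore] -/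
theorem sum_jtNormSq_jtPull_le (D E : ℕ) (γ : ℕ → ℕ → ℂ) :
    ∑ e ∈ Icc 1 E, jtNormSq (D / e) (2 * D / e) (jtPull γ e) ≤ jtNormSq D (2 * D) γ := by
  -- write everything over sigma types
  have hL : ∀ e ∈ Icc 1 E, jtNormSq (D / e) (2 * D / e) (jtPull γ e) =
      ∑ x ∈ ((Ioc (D / e) (2 * D / e)).sigma fun d₁ => (range d₁).filter fun a₁ => a₁.Coprime d₁),
        ‖γ (e * x.1) (e * x.2)‖ ^ 2 := by
    intro e _
    rw [jtNormSq_def, sum_sigma]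
    refine sum_congr rfl fun d₁ _ => ?_
    rw [sum_filter]
    refine sum_congr rfl fun a₁ _ => ?_
    rw [jtPull_def]
    split_ifs <;> simp
  set S3 := (Icc 1 E).sigma fun e => (Ioc (D / e) (2 * D / e)).sigma fun d₁ =>
      (range d₁).filter fun a₁ => a₁.Coprime d₁ with hS3
  set F : (Σ _ : ℕ, ℕ) → ℝ := fun y => ‖γ y.1 y.2‖ ^ 2 with hF
  set gmap : (Σ _ : ℕ, Σ _ : ℕ, ℕ) → (Σ _ : ℕ, ℕ) := fun x => ⟨x.1 * x.2.1, x.1 * x.2.2⟩ with hg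
  have e1 : ∑ e ∈ Icc 1 E, jtNormSq (D / e) (2 * D / e) (jtPull γ e) = ∑ x ∈ S3, F (gmap x) := by
    rw [sum_congr rfl hL, hS3, sum_sigma]
  have e2 : jtNormSq D (2 * D) γ = ∑ y ∈ (Ioc D (2 * D)).sigma (fun d => range d), F y := by
    rw [jtNormSq_def, sum_sigma]
  rw [e1, e2]
  have hinj : Set.InjOn gmap ↑S3 := by
    intro x hx y hy hxy
    simp only [hS3, coe_sigma, Set.mem_sigma_iff, mem_coe, mem_Icc, mem_Ioc, mem_filter, mem_range] at hx hy
    simp only [hg, Sigma.mk.injEq, heq_eq_eq] at hxy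
    obtain ⟨h1, h2⟩ := hxy
    have hex : x.1 = Nat.gcd (x.1 * x.2.2) (x.1 * x.2.1) := by
      rw [Nat.gcd_mul_left, Nat.Coprime.gcd_eq_one hx.2.2.2, mul_one]
    have hey : y.1 = Nat.gcd (y.1 * y.2.2) (y.1 * y.2.1) := by
      rw [Nat.gcd_mul_left, Nat.Coprime.gcd_eq_one hy.2.2.2, mul_one]
    have he : x.1 = y.1 := by rw [hex, hey, h1, h2]
    have hx1 : 0 < x.1 := by omega
    have hd : x.2.1 = y.2.1 := Nat.eq_of_mul_eq_mul_left hx1 (by rw [h1, he])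
    have ha : x.2.2 = y.2.2 := Nat.eq_of_mul_eq_mul_left hx1 (by rw [h2, he])
    exact Sigma.ext he (heq_of_eq (Sigma.ext hd (heq_of_eq ha)))
  rw [← sum_image (g := gmap) (f := F) hinj]
  refine sum_le_sum_of_subset_of_nonneg ?_ fun _ _ _ => by positivity
  intro y hy
  rw [mem_image] at hy
  obtain ⟨x, hx, rfl⟩ := hy
  simp only [hS3, mem_sigma, mem_Icc, mem_Ioc, mem_filter, mem_range] at hx
  obtain ⟨⟨he1, _⟩, ⟨hd1, hd2⟩, ha, _⟩ := hx
  simp only [hg, mem_sigma, mem_Ioc, mem_range]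
  refine ⟨⟨?_, ?_⟩, Nat.mul_lt_mul_of_pos_left ha (by omega)⟩
  · by_contra hcon
    have hcon' : x.1 * x.2.1 ≤ D := not_lt.mp hcon
    have : x.2.1 ≤ D / x.1 := (Nat.le_div_iff_mul_le (by omega)).mpr (by rw [mul_comm]; exact hcon')
    omega
  · calc x.1 * x.2.1 ≤ x.1 * (2 * D / x.1) := Nat.mul_le_mul_left _ hd2
      _ ≤ 2 * D := Nat.mul_div_le (2 * D) x.1




/-! ### W8: regrouping the inner sum by `e = (s, d)` -/

/-- The inner sum of `W` at level `(D₁, D₂]` for the vector `γ` and the pair `(r, s)`: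
`Z(r, s) = ∑_{D₁<d≤D₂, (r,d)=1} γ_d(s r̄) χ_d(r)`. [folklore] -/
def jtInner (D₁ D₂ : ℕ) (γ : ℕ → ℕ → ℂ) (r s : ℕ) : ℂ :=
  ∑ d ∈ (Ioc D₁ D₂).filter (fun d => r.Coprime d), γ d (congrSol d r s) * (jtChar d r : ℂ)

/-- Unfolding `jtInner`. [folklore] -/
theorem jtInner_def (D₁ D₂ : ℕ) (γ : ℕ → ℕ → ℂ) (r s : ℕ) : jtInner D₁ D₂ γ r s =
    ∑ d ∈ (Ioc D₁ D₂).filter (fun d => r.Coprime d), γ d (congrSol d r s) * (jtChar d r : ℂ) := rfl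

/-- `W` as the sum of `|Z(r,s)|²` (`jtW_eq_sum_congrSol`). [folklore] -/
theorem jtW_eq_sum_jtInner (D₁ D₂ R S : ℕ) (γ : ℕ → ℕ → ℂ) :
    jtW D₁ D₂ R S γ = ∑ r ∈ Ioc R (2 * R), ∑ s ∈ Ioc S (2 * S), ‖jtInner D₁ D₂ γ r s‖ ^ 2 := by
  rw [jtW_eq_sum_congrSol]; rfl

/-- **Regrouping by `e = (s, d)`** ("`e` stands for the common divisor of `a` and `d`"): with
`d = e d₁`, `s = e s₁`, the class `s r̄ (mod d)` is `e · (s₁ r̄ mod d₁)`, `(s₁, d₁) = 1`, and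
`χ_d = χ_e χ_{d₁}`; hence
`Z(r, s) = ∑_{e ≤ 2D, e ∣ s} χ_e(r) 1_{(r,e)=1} · Z^{(e)}(r, s/e)`, where `Z^{(e)}` is the inner sum at
level `(D/e, 2D/e]` for `γ^{(e)}` (`jtPull`). [cite: FriedlanderIwaniecAnnals1998, §11, end of the proof of (11.19)] -/
theorem jtInner_eq_sum_pull (D : ℕ) (γ : ℕ → ℕ → ℂ) (r s : ℕ) :
    jtInner D (2 * D) γ r s = ∑ e ∈ (Icc 1 (2 * D)).filter (fun e => e ∣ s),
      (if r.Coprime e then (jtChar e r : ℂ) else 0) * jtInner (D / e) (2 * D / e) (jtPull γ e) r (s / e) := by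
  classical
  set E := (Icc 1 (2 * D)).filter (fun e => e ∣ s) with hE
  -- Step 1: the right side as a sum over pairs `(e, d₁)` with all conditions in a filter
  set P := (E.sigma fun e => (Ioc (D / e) (2 * D / e)).filter fun d₁ => r.Coprime d₁).filter
    (fun x => r.Coprime x.1 ∧ (s / x.1).Coprime x.2) with hP
  have hRHS : ∑ e ∈ E, (if r.Coprime e then (jtChar e r : ℂ) else 0) *
      jtInner (D / e) (2 * D / e) (jtPull γ e) r (s / e) =
      ∑ x ∈ P, (jtChar x.1 r : ℂ) * (γ (x.1 * x.2) (x.1 * congrSol x.2 r (s / x.1)) * (jtChar x.2 r : ℂ)) := by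
    conv_rhs => rw [hP, sum_filter, sum_sigma]
    refine sum_congr rfl fun e _ => ?_
    rw [jtInner_def, mul_sum]
    refine sum_congr rfl fun d₁ hd₁ => ?_
    have hd₁0 : 0 < d₁ := lt_of_le_of_lt (Nat.zero_le _) (mem_Ioc.mp (mem_filter.mp hd₁).1).1
    have hrd₁ : r.Coprime d₁ := (mem_filter.mp hd₁).2
    by_cases hre : r.Coprime e
    · rw [if_pos hre, jtPull_def]
      by_cases hsd : (s / e).Coprime d₁
      · rw [if_pos (coprime_congrSol hrd₁ hsd), if_pos ⟨hre, hsd⟩]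
      · rw [if_neg (not_coprime_congrSol hd₁0 hrd₁ hsd), if_neg (fun h => hsd h.2), zero_mul, mul_zero]
    · rw [if_neg hre, zero_mul, if_neg (fun h => hre h.1)]
  rw [hRHS, jtInner_def]
  -- Step 2: the bijection `(e, d₁) ↦ e d₁`, inverse `d ↦ ((s, d), d/(s, d))`
  symm
  refine sum_nbij' (fun x => x.1 * x.2) (fun d => ⟨Nat.gcd s d, d / Nat.gcd s d⟩) ?_ ?_ ?_ ?_ ?_
  · intro x hx
    simp only [hP, hE, mem_filter, mem_sigma, mem_Icc, mem_Ioc] at hx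
    obtain ⟨⟨⟨⟨he1, he2⟩, hes⟩, ⟨hd1, hd2⟩, hrd⟩, hre, hsd⟩ := hx
    rw [mem_filter, mem_Ioc]
    refine ⟨⟨?_, ?_⟩, Nat.Coprime.mul_right hre hrd⟩
    · by_contra hcon
      have hcon' : x.1 * x.2 ≤ D := not_lt.mp hcon
      have : x.2 ≤ D / x.1 := (Nat.le_div_iff_mul_le (by omega)).mpr (by rw [mul_comm]; exact hcon')
      omega
    · calc x.1 * x.2 ≤ x.1 * (2 * D / x.1) := Nat.mul_le_mul_left _ hd2
        _ ≤ 2 * D := Nat.mul_div_le (2 * D) x.1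
  · intro d hd
    rw [mem_filter, mem_Ioc] at hd
    obtain ⟨⟨hd1, hd2⟩, hrd⟩ := hd
    have hd0 : 0 < d := by omega
    set e := Nat.gcd s d with he
    have he0 : 0 < e := Nat.gcd_pos_of_pos_right _ hd0
    have hed : e ∣ d := Nat.gcd_dvd_right s d
    have hes : e ∣ s := Nat.gcd_dvd_left s d
    have heled : e ≤ d := Nat.le_of_dvd hd0 hed
    simp only [hP, hE, mem_filter, mem_sigma, mem_Icc, mem_Ioc]
    refine ⟨⟨⟨⟨he0, by omega⟩, hes⟩, ⟨?_, Nat.div_le_div_right hd2⟩, hrd.coprime_dvd_right (Nat.div_dvd_of_dvd hed)⟩,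
      hrd.coprime_dvd_right hed, ?_⟩
    · -- `D / e < d / e`
      have h1 : d / e * e = d := Nat.div_mul_cancel hed
      by_contra hcon
      have hcon' : d / e ≤ D / e := not_lt.mp hcon
      have : d ≤ D / e * e := by rw [← h1]; exact Nat.mul_le_mul_right e hcon'
      have := this.trans (Nat.div_mul_le_self D e)
      omega
    · rw [he]; exact Nat.coprime_div_gcd_div_gcd he0
  · intro x hx
    simp only [hP, hE, mem_filter, mem_sigma, mem_Icc, mem_Ioc] at hx
    obtain ⟨⟨⟨⟨he1, he2⟩, hes⟩, ⟨hd1, hd2⟩, hrd⟩, hre, hsd⟩ := hx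
    have hg : Nat.gcd s (x.1 * x.2) = x.1 := by
      conv_lhs => rw [← Nat.div_mul_cancel hes, mul_comm (s / x.1) x.1, Nat.gcd_mul_left,
        Nat.Coprime.gcd_eq_one hsd, mul_one]
    change (⟨Nat.gcd s (x.1 * x.2), x.1 * x.2 / Nat.gcd s (x.1 * x.2)⟩ : Σ _ : ℕ, ℕ) = x
    rw [hg, Nat.mul_div_cancel_left _ (by omega)]
  · intro d hd
    rw [mem_filter, mem_Ioc] at hd
    exact Nat.mul_div_cancel' (Nat.gcd_dvd_right s d)
  · intro x hx
    simp only [hP, hE, mem_filter, mem_sigma, mem_Icc, mem_Ioc] at hx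
    obtain ⟨⟨⟨⟨he1, he2⟩, hes⟩, ⟨hd1, hd2⟩, hrd⟩, hre, hsd⟩ := hx
    have hx2 : 0 < x.2 := lt_of_le_of_lt (Nat.zero_le _) hd1
    have hcop : r.Coprime (x.1 * x.2) := Nat.Coprime.mul_right hre hrd
    conv_rhs => rw [← Nat.div_mul_cancel hes, mul_comm (s / x.1) x.1]
    rw [congrSol_mul_mul (by omega) hx2 hcop, ← jtChar_mul_jtChar (by omega) hx2 r]
    push_cast
    ring




/-- **Dilation of the second variable:** `Z(γ'; r, f t) = Z(γ'_f; r, t)` with `γ'_f = jtDilate γ' f`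
(as `(f t) r̄ ≡ f · (t r̄)`). [folklore] -/
theorem jtInner_mul_eq_jtInner_jtDilate (D₁ D₂ : ℕ) (γ' : ℕ → ℕ → ℂ) (r f t : ℕ) :
    jtInner D₁ D₂ γ' r (f * t) = jtInner D₁ D₂ (jtDilate γ' f) r t := by
  rw [jtInner_def, jtInner_def]
  refine sum_congr rfl fun d hd => ?_
  have hd0 : 0 < d := lt_of_le_of_lt (Nat.zero_le _) (mem_Ioc.mp (mem_filter.mp hd).1).1
  rw [jtDilate_def, congrSol_mul_left hd0 (mem_filter.mp hd).2]

/-- For `(a, d) = 1`, the `r ∈ (R, 2R]` prime to `d` with `t r̄ ≡ a (mod d)` lie in one class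
modulo `d`, so number at most `R/d + 1`. [folklore] -/
theorem card_Ioc_filter_congrSol_fst_le {d a : ℕ} (hd : 0 < d) (ha : a.Coprime d) (R t : ℕ) :
    (#((Ioc R (2 * R)).filter fun r => r.Coprime d ∧ congrSol d r t = a) : ℝ) ≤ (R : ℝ) / d + 1 := by
  have h := card_le_of_forall_dvd_sub_int
    (F := ((Ioc R (2 * R)).filter fun r => r.Coprime d ∧ congrSol d r t = a).map Nat.castEmbedding)
    (lo := (R : ℤ) + 1) (hi := 2 * R) (q := d)
    (fun x hx => by
      rw [mem_map] at hx
      obtain ⟨r, hr, rfl⟩ := hx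
      rw [mem_filter, mem_Ioc] at hr
      simp only [Nat.castEmbedding_apply]; omega)
    (fun x hx y hy => by
      rw [mem_map] at hx hy
      obtain ⟨r, hr, rfl⟩ := hx
      obtain ⟨r', hr', rfl⟩ := hy
      rw [mem_filter] at hr hr'
      simp only [Nat.castEmbedding_apply]
      have h1 := dvd_sub_congrSol_mul hd hr.2.1 t
      have h2 := dvd_sub_congrSol_mul hd hr'.2.1 t
      rw [hr.2.2] at h1; rw [hr'.2.2] at h2
      have h3 : (d : ℤ) ∣ (a : ℤ) * ((r' : ℤ) - r) := by
        have he : (a : ℤ) * ((r' : ℤ) - r) = ((t : ℤ) - (a : ℤ) * r) - ((t : ℤ) - (a : ℤ) * r') := by ring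
        rw [he]; exact dvd_sub h1 h2
      have h4 : (d : ℤ) ∣ (r' : ℤ) - r := by
        refine Int.dvd_of_dvd_mul_right_of_gcd_one h3 ?_
        rw [Int.gcd_comm, Int.gcd_natCast_natCast]; exact ha
      rw [← dvd_neg, neg_sub] at h4; exact h4)
  rw [card_map] at h
  have h2 : ((2 * R : ℤ) - ((R : ℤ) + 1)).toNat ≤ R := by omega
  calc (#((Ioc R (2 * R)).filter fun r => r.Coprime d ∧ congrSol d r t = a) : ℝ)
      ≤ ((((2 * R : ℤ) - ((R : ℤ) + 1)).toNat / d + 1 : ℕ) : ℝ) := by exact_mod_cast h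
    _ ≤ ((R / d + 1 : ℕ) : ℝ) := by exact_mod_cast Nat.add_le_add_right (Nat.div_le_div_right h2) 1
    _ ≤ (R : ℝ) / d + 1 := by
        push_cast
        have hcd : ((R / d : ℕ) : ℝ) ≤ (R : ℝ) / d := Nat.cast_div_le
        linarith

/-- **The trivial bound for a single `t`** (used for the slices `s = lcm(e, f)`, i.e. `t = 1`): for
`γ'` supported on the unit classes,
`∑_{R<r≤2R} |Z(γ'; r, t)|² ≤ (D₂ − D₁)(R/(D₁+1) + 1) ‖γ'‖²`. [folklore] -/
theorem sum_norm_jtInner_sq_le_trivial {D₁ D₂ : ℕ} {γ' : ℕ → ℕ → ℂ} (hγ : IsUnitSupported D₁ D₂ γ')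
    (R t : ℕ) :
    ∑ r ∈ Ioc R (2 * R), ‖jtInner D₁ D₂ γ' r t‖ ^ 2 ≤
      ((D₂ - D₁ : ℕ) : ℝ) * ((R : ℝ) / (D₁ + 1) + 1) * jtNormSq D₁ D₂ γ' := by
  set 𝒟 := Ioc D₁ D₂ with h𝒟
  have h𝒟card : #𝒟 = D₂ - D₁ := Nat.card_Ioc _ _
  set M : ℝ := (R : ℝ) / (D₁ + 1) + 1 with hM
  have hM0 : 0 ≤ M := by positivity
  -- Cauchy–Schwarz in `d`
  have h1 : ∀ r : ℕ, ‖jtInner D₁ D₂ γ' r t‖ ^ 2 ≤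
      #𝒟 * ∑ d ∈ 𝒟, (if r.Coprime d then ‖γ' d (congrSol d r t)‖ ^ 2 else 0) := by
    intro r
    rw [jtInner_def]
    refine (norm_sum_sq_le_card_mul _ _).trans ?_
    refine mul_le_mul (by exact_mod_cast card_le_card (filter_subset _ _)) ?_
      (sum_nonneg fun _ _ => by positivity) (Nat.cast_nonneg _)
    rw [sum_filter]
    refine sum_le_sum fun d _ => ?_
    split_ifs
    · rw [norm_mul]
      calc (‖γ' d (congrSol d r t)‖ * ‖(jtChar d r : ℂ)‖) ^ 2 ≤ (‖γ' d (congrSol d r t)‖ * 1) ^ 2 := by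
            gcongr; exact norm_jtChar_le_one d r
        _ = _ := by rw [mul_one]
    · exact le_refl _
  -- the count for each `d`
  have h2 : ∀ d ∈ 𝒟, ∑ r ∈ Ioc R (2 * R), (if r.Coprime d then ‖γ' d (congrSol d r t)‖ ^ 2 else 0) ≤
      M * ∑ a ∈ range d, ‖γ' d a‖ ^ 2 := by
    intro d hd
    have hd0 : 0 < d := by rw [h𝒟, mem_Ioc] at hd; omega
    have hdD : (D₁ : ℝ) + 1 ≤ d := by rw [h𝒟, mem_Ioc] at hd; exact_mod_cast hd.1
    rw [← sum_filter, ← sum_fiberwise_of_maps_to (s := (Ioc R (2 * R)).filter fun r => r.Coprime d)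
      (t := range d) (g := fun r => congrSol d r t) (fun r _ => mem_range.mpr (congrSol_lt hd0 r t)), mul_sum]
    refine sum_le_sum fun a ha => ?_
    rw [filter_filter, sum_congr rfl fun r hr => by rw [(mem_filter.mp hr).2.2], sum_const, nsmul_eq_mul]
    by_cases hac : a.Coprime d
    · calc (#((Ioc R (2 * R)).filter fun r => r.Coprime d ∧ congrSol d r t = a) : ℝ) * ‖γ' d a‖ ^ 2
          ≤ ((R : ℝ) / d + 1) * ‖γ' d a‖ ^ 2 :=
            mul_le_mul_of_nonneg_right (card_Ioc_filter_congrSol_fst_le hd0 hac R t) (by positivity)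
        _ ≤ M * ‖γ' d a‖ ^ 2 := by rw [hM]; gcongr
    · rw [hγ d (by rwa [h𝒟] at hd) a (mem_range.mp ha) hac, norm_zero, zero_pow two_ne_zero, mul_zero, mul_zero]
  calc ∑ r ∈ Ioc R (2 * R), ‖jtInner D₁ D₂ γ' r t‖ ^ 2
      ≤ ∑ r ∈ Ioc R (2 * R), (#𝒟 : ℝ) * ∑ d ∈ 𝒟, (if r.Coprime d then ‖γ' d (congrSol d r t)‖ ^ 2 else 0) :=
        sum_le_sum fun r _ => h1 r
    _ = (#𝒟 : ℝ) * ∑ d ∈ 𝒟, ∑ r ∈ Ioc R (2 * R), (if r.Coprime d then ‖γ' d (congrSol d r t)‖ ^ 2 else 0) := by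
        rw [← mul_sum, sum_comm]
    _ ≤ (#𝒟 : ℝ) * ∑ d ∈ 𝒟, M * ∑ a ∈ range d, ‖γ' d a‖ ^ 2 :=
        mul_le_mul_of_nonneg_left (sum_le_sum h2) (Nat.cast_nonneg _)
    _ = ((D₂ - D₁ : ℕ) : ℝ) * M * jtNormSq D₁ D₂ γ' := by
        rw [← mul_sum, jtNormSq_def, h𝒟card]; ring




/-! ### W8: Cauchy's inequality over `e ∣ s` and the `(e, f)` double sum -/

/-- Weighted Cauchy–Schwarz: `‖∑_{e ∈ E} c_e Z_e‖² ≤ (∑_{e∈E} e^{-α}) ∑_{e ∈ E} e^{α} ‖Z_e‖²` for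
`|c_e| ≤ 1` and `E ⊆ ℕ_{≥1}`. [folklore] -/
theorem norm_sum_sq_le_weighted {E : Finset ℕ} (hE : ∀ e ∈ E, 1 ≤ e) (c Z : ℕ → ℂ)
    (hc : ∀ e, ‖c e‖ ≤ 1) (α : ℝ) :
    ‖∑ e ∈ E, c e * Z e‖ ^ 2 ≤
      (∑ e ∈ E, (e : ℝ) ^ (-α)) * ∑ e ∈ E, (e : ℝ) ^ α * ‖Z e‖ ^ 2 := by
  have h1 : ‖∑ e ∈ E, c e * Z e‖ ≤ ∑ e ∈ E, (e : ℝ) ^ (-α / 2) * ((e : ℝ) ^ (α / 2) * ‖Z e‖) := by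
    refine (norm_sum_le _ _).trans (sum_le_sum fun e he => ?_)
    have he0 : (0 : ℝ) < e := by exact_mod_cast hE e he
    rw [norm_mul, ← mul_assoc, ← Real.rpow_add he0, show -α / 2 + α / 2 = 0 by ring, Real.rpow_zero, one_mul]
    calc ‖c e‖ * ‖Z e‖ ≤ 1 * ‖Z e‖ := mul_le_mul_of_nonneg_right (hc e) (norm_nonneg _)
      _ = ‖Z e‖ := one_mul _
  have h0 : 0 ≤ ∑ e ∈ E, (e : ℝ) ^ (-α / 2) * ((e : ℝ) ^ (α / 2) * ‖Z e‖) :=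
    sum_nonneg fun e _ => by positivity
  calc ‖∑ e ∈ E, c e * Z e‖ ^ 2 ≤ (∑ e ∈ E, (e : ℝ) ^ (-α / 2) * ((e : ℝ) ^ (α / 2) * ‖Z e‖)) ^ 2 :=
        pow_le_pow_left₀ (norm_nonneg _) h1 2
    _ ≤ (∑ e ∈ E, ((e : ℝ) ^ (-α / 2)) ^ 2) * ∑ e ∈ E, ((e : ℝ) ^ (α / 2) * ‖Z e‖) ^ 2 :=
        sum_mul_sq_le_sq_mul_sq _ _ _
    _ = (∑ e ∈ E, (e : ℝ) ^ (-α)) * ∑ e ∈ E, (e : ℝ) ^ α * ‖Z e‖ ^ 2 := by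
        congr 1
        · refine sum_congr rfl fun e he => ?_
          have he0 : (0 : ℝ) ≤ e := Nat.cast_nonneg e
          rw [← Real.rpow_natCast, ← Real.rpow_mul he0]; norm_num
        · refine sum_congr rfl fun e he => ?_
          have he0 : (0 : ℝ) ≤ e := Nat.cast_nonneg e
          rw [mul_pow, ← Real.rpow_natCast ((e : ℝ) ^ (α / 2)), ← Real.rpow_mul he0]; norm_num

/-- **`W ≤ ∑_e ∑_f e^α f^{-α} ∑_r ∑_{s : e ∣ s, f ∣ s} |Z^{(e)}(r, s/e)|²`** ("by Cauchy's inequality, for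
any `e^α f^{-α}`"). [cite: FriedlanderIwaniecAnnals1998, §11, end of the proof of (11.19)] -/
theorem jtW_le_sum_pairs_ef (D R S : ℕ) (γ : ℕ → ℕ → ℂ) (α : ℝ) :
    jtW D (2 * D) R S γ ≤ ∑ e ∈ Icc 1 (2 * D), ∑ f ∈ Icc 1 (2 * D), (e : ℝ) ^ α * (f : ℝ) ^ (-α) *
      ∑ r ∈ Ioc R (2 * R), ∑ s ∈ (Ioc S (2 * S)).filter (fun s => e ∣ s ∧ f ∣ s),
        ‖jtInner (D / e) (2 * D / e) (jtPull γ e) r (s / e)‖ ^ 2 := by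
  rw [jtW_eq_sum_jtInner]
  set I := Icc 1 (2 * D) with hI
  set Z : ℕ → ℕ → ℕ → ℂ := fun e r s => jtInner (D / e) (2 * D / e) (jtPull γ e) r (s / e) with hZ
  -- Cauchy–Schwarz for each `(r, s)`
  have hCS : ∀ r s : ℕ, ‖jtInner D (2 * D) γ r s‖ ^ 2 ≤
      (∑ f ∈ I.filter (fun f => f ∣ s), (f : ℝ) ^ (-α)) *
        ∑ e ∈ I.filter (fun e => e ∣ s), (e : ℝ) ^ α * ‖Z e r s‖ ^ 2 := by
    intro r s
    rw [jtInner_eq_sum_pull]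
    refine norm_sum_sq_le_weighted (fun e he => (mem_Icc.mp (mem_filter.mp he).1).1) _ _ (fun e => ?_) α
    split_ifs
    · exact norm_jtChar_le_one e r
    · simp
  -- expand the product and exchange
  have hexp : ∀ r s : ℕ, (∑ f ∈ I.filter (fun f => f ∣ s), (f : ℝ) ^ (-α)) *
      ∑ e ∈ I.filter (fun e => e ∣ s), (e : ℝ) ^ α * ‖Z e r s‖ ^ 2 =
      ∑ e ∈ I, ∑ f ∈ I, (if e ∣ s ∧ f ∣ s then (e : ℝ) ^ α * (f : ℝ) ^ (-α) * ‖Z e r s‖ ^ 2 else 0) := by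
    intro r s
    rw [mul_comm, sum_mul_sum, sum_filter]
    refine sum_congr rfl fun e _ => ?_
    by_cases he : e ∣ s
    · rw [if_pos he, sum_filter]
      refine sum_congr rfl fun f _ => ?_
      by_cases hf : f ∣ s
      · rw [if_pos hf, if_pos ⟨he, hf⟩]; ring
      · rw [if_neg hf, if_neg (fun h => hf h.2)]
    · rw [if_neg he]
      refine (sum_eq_zero fun f _ => ?_).symm
      rw [if_neg (fun h => he h.1)]
  calc ∑ r ∈ Ioc R (2 * R), ∑ s ∈ Ioc S (2 * S), ‖jtInner D (2 * D) γ r s‖ ^ 2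
      ≤ ∑ r ∈ Ioc R (2 * R), ∑ s ∈ Ioc S (2 * S), ∑ e ∈ I, ∑ f ∈ I,
          (if e ∣ s ∧ f ∣ s then (e : ℝ) ^ α * (f : ℝ) ^ (-α) * ‖Z e r s‖ ^ 2 else 0) :=
        sum_le_sum fun r _ => sum_le_sum fun s _ => (hCS r s).trans (le_of_eq (hexp r s))
    _ = ∑ r ∈ Ioc R (2 * R), ∑ e ∈ I, ∑ f ∈ I, (e : ℝ) ^ α * (f : ℝ) ^ (-α) *
          ∑ s ∈ (Ioc S (2 * S)).filter (fun s => e ∣ s ∧ f ∣ s), ‖Z e r s‖ ^ 2 := by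
        refine sum_congr rfl fun r _ => ?_
        rw [sum_comm]
        refine sum_congr rfl fun e _ => ?_
        rw [sum_comm]
        refine sum_congr rfl fun f _ => ?_
        rw [sum_filter, mul_sum]
        refine sum_congr rfl fun s _ => ?_
        split_ifs
        · rfl
        · rw [mul_zero]
    _ = ∑ e ∈ I, ∑ f ∈ I, (e : ℝ) ^ α * (f : ℝ) ^ (-α) *
          ∑ r ∈ Ioc R (2 * R), ∑ s ∈ (Ioc S (2 * S)).filter (fun s => e ∣ s ∧ f ∣ s), ‖Z e r s‖ ^ 2 := by
        rw [sum_comm]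
        refine sum_congr rfl fun e _ => ?_
        rw [sum_comm]
        refine sum_congr rfl fun f _ => ?_
        rw [mul_sum]




/-- **Reindexing `s = [e, f] t`:** the `s ∈ (S, 2S]` divisible by `e` and `f` are the `ℓ t`,
`ℓ = [e, f]`, `S/ℓ < t ≤ 2S/ℓ`, and `s/e = (ℓ/e) t`. [folklore] -/
theorem sum_filter_dvd_dvd_eq_sum_lcm {e f : ℕ} (he : 0 < e) (hf : 0 < f) (S : ℕ) (F : ℕ → ℝ) :
    ∑ s ∈ (Ioc S (2 * S)).filter (fun s => e ∣ s ∧ f ∣ s), F (s / e) =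
      ∑ t ∈ Ioc (S / Nat.lcm e f) (2 * S / Nat.lcm e f), F (Nat.lcm e f / e * t) := by
  set l := Nat.lcm e f with hl
  have hl0 : 0 < l := Nat.lcm_pos he hf
  have hel : e ∣ l := Nat.dvd_lcm_left e f
  have hfl : f ∣ l := Nat.dvd_lcm_right e f
  symm
  refine sum_nbij' (fun t => l * t) (fun s => s / l) ?_ ?_ ?_ ?_ ?_
  · intro t ht
    rw [mem_Ioc] at ht
    rw [mem_filter, mem_Ioc]
    refine ⟨⟨?_, ?_⟩, hel.mul_right t, hfl.mul_right t⟩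
    · -- `S / l < t ⇒ S < l t`
      have h1 : S / l + 1 ≤ t := ht.1
      have h2 : S < l * (S / l + 1) := by
        rw [mul_add, mul_one, mul_comm]
        exact Nat.lt_div_mul_add hl0
      exact lt_of_lt_of_le h2 (Nat.mul_le_mul_left l h1)
    · calc l * t ≤ l * (2 * S / l) := Nat.mul_le_mul_left l ht.2
        _ ≤ 2 * S := Nat.mul_div_le (2 * S) l
  · intro s hs
    rw [mem_filter, mem_Ioc] at hs
    obtain ⟨⟨hs1, hs2⟩, hes, hfs⟩ := hs
    have hls : l ∣ s := Nat.lcm_dvd hes hfs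
    rw [mem_Ioc]
    constructor
    · by_contra hcon
      have hcon' : s / l ≤ S / l := not_lt.mp hcon
      have : s ≤ S := by
        calc s = l * (s / l) := (Nat.mul_div_cancel' hls).symm
          _ ≤ l * (S / l) := Nat.mul_le_mul_left l hcon'
          _ ≤ S := Nat.mul_div_le S l
      omega
    · exact Nat.div_le_div_right hs2
  · intro t _
    exact Nat.mul_div_cancel_left t hl0
  · intro s hs
    rw [mem_filter] at hs
    exact Nat.mul_div_cancel' (Nat.lcm_dvd hs.2.1 hs.2.2)
  · intro t _
    congr 1
    -- `(l t) / e = (l / e) t`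
    obtain ⟨k, hk⟩ := hel
    rw [hk, Nat.mul_div_cancel_left k he, mul_assoc, Nat.mul_div_cancel_left _ he]

/-- The bound of (11.24) as a function of the scale `x` of the second variable:
`R x √D₂/(D₁+1) + (x R^{3/4} + R x^{3/4} + D₂ √(R x)) (D₂ R x)^ε`. [folklore] -/
def jtBnd (ε : ℝ) (D₁ D₂ R : ℕ) (x : ℝ) : ℝ :=
  (R : ℝ) * x * Real.sqrt D₂ / (D₁ + 1) +
    (x * (R : ℝ) ^ (3 / 4 : ℝ) + (R : ℝ) * x ^ (3 / 4 : ℝ) + D₂ * Real.sqrt ((R : ℝ) * x)) * ((D₂ : ℝ) * R * x) ^ ε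

/-- Unfolding `jtBnd`. [folklore] -/
theorem jtBnd_def (ε : ℝ) (D₁ D₂ R : ℕ) (x : ℝ) : jtBnd ε D₁ D₂ R x =
    (R : ℝ) * x * Real.sqrt D₂ / (D₁ + 1) +
    (x * (R : ℝ) ^ (3 / 4 : ℝ) + (R : ℝ) * x ^ (3 / 4 : ℝ) + D₂ * Real.sqrt ((R : ℝ) * x)) * ((D₂ : ℝ) * R * x) ^ ε := rfl

/-- `jtBnd ≥ 0` for a nonnegative scale. [folklore] -/
theorem jtBnd_nonneg {ε : ℝ} (D₁ D₂ R : ℕ) {x : ℝ} (hx : 0 ≤ x) : 0 ≤ jtBnd ε D₁ D₂ R x := by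
  rw [jtBnd_def]; positivity

/-- `jtBnd` is increasing in the scale. [folklore] -/
theorem jtBnd_mono {ε : ℝ} (hε : 0 ≤ ε) (D₁ D₂ R : ℕ) {x y : ℝ} (hx : 0 ≤ x) (hxy : x ≤ y) :
    jtBnd ε D₁ D₂ R x ≤ jtBnd ε D₁ D₂ R y := by
  rw [jtBnd_def, jtBnd_def]
  have hy : 0 ≤ y := hx.trans hxy
  have hR : (0 : ℝ) ≤ R := Nat.cast_nonneg R
  have hD : (0 : ℝ) ≤ D₂ := Nat.cast_nonneg D₂
  have h1 : x ^ (3 / 4 : ℝ) ≤ y ^ (3 / 4 : ℝ) := Real.rpow_le_rpow hx hxy (by norm_num)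
  have h2 : Real.sqrt ((R : ℝ) * x) ≤ Real.sqrt ((R : ℝ) * y) :=
    Real.sqrt_le_sqrt (mul_le_mul_of_nonneg_left hxy hR)
  have h3 : ((D₂ : ℝ) * R * x) ^ ε ≤ ((D₂ : ℝ) * R * y) ^ ε :=
    Real.rpow_le_rpow (by positivity) (mul_le_mul_of_nonneg_left hxy (by positivity)) hε
  have h4 : (R : ℝ) * x * Real.sqrt D₂ / (D₁ + 1) ≤ (R : ℝ) * y * Real.sqrt D₂ / (D₁ + 1) := by
    refine div_le_div_of_nonneg_right ?_ (by positivity)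
    exact mul_le_mul_of_nonneg_right (mul_le_mul_of_nonneg_left hxy hR) (Real.sqrt_nonneg _)
  have h5 : x * (R : ℝ) ^ (3 / 4 : ℝ) + (R : ℝ) * x ^ (3 / 4 : ℝ) + D₂ * Real.sqrt ((R : ℝ) * x) ≤
      y * (R : ℝ) ^ (3 / 4 : ℝ) + (R : ℝ) * y ^ (3 / 4 : ℝ) + D₂ * Real.sqrt ((R : ℝ) * y) := by
    refine add_le_add (add_le_add ?_ ?_) ?_
    · exact mul_le_mul_of_nonneg_right hxy (by positivity)
    · exact mul_le_mul_of_nonneg_left h1 hR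
    · exact mul_le_mul_of_nonneg_left h2 hD
  exact add_le_add h4 (mul_le_mul h5 h3 (by positivity) (by positivity))

/-- (11.24) in terms of `jtBnd`. [folklore] -/
theorem exists_jtW_le_jtBnd {ε : ℝ} (hε : 0 < ε) (hε1 : ε ≤ 1) :
    ∃ C : ℝ, 0 < C ∧ ∀ (D₁ D₂ R S : ℕ) (γ : ℕ → ℕ → ℂ), 1 ≤ R → 1 ≤ S → IsUnitSupported D₁ D₂ γ →
      jtW D₁ D₂ R S γ ≤ C * jtBnd ε D₁ D₂ R S * jtNormSq D₁ D₂ γ := by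
  obtain ⟨C, hC0, hC⟩ := exists_jtW_le_unitSupported hε hε1
  refine ⟨C, hC0, fun D₁ D₂ R S γ hR hS hγ => ?_⟩
  have h := hC D₁ D₂ R S γ hR hS hγ
  rw [jtBnd_def]
  convert h using 3




/-- **The bound for one `(e, f)`-piece** (a sum over `t ∈ (A, B]`, `2A ≤ B ≤ 2A + 1`, of a dual form
at level `(D₁, D₂]`, `D₂ ≤ 2(D₁ + 1)`, for a unit-supported vector): `≤ C · jtBnd(B) ‖γ'‖²`. For `A ≥ 1`
cover `(A, B]` by `(A, 2A] ∪ (A+1, 2A+2]` and use (11.24) twice (monotonicity in the scale); for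
`A = 0`, `B = 1` it is the single slice `t = 1`, bounded trivially by `2R + D₂ ≤ 2 jtBnd(1)`.
[cite: FriedlanderIwaniecAnnals1998, §11, end of the proof of (11.19)] -/
theorem exists_piece_le {ε : ℝ} (hε : 0 < ε) (hε1 : ε ≤ 1) :
    ∃ C : ℝ, 0 < C ∧ ∀ (D₁ D₂ R A B : ℕ) (γ' : ℕ → ℕ → ℂ), 1 ≤ R → IsUnitSupported D₁ D₂ γ' →
      D₂ ≤ 2 * (D₁ + 1) → 2 * A ≤ B → B ≤ 2 * A + 1 →
      ∑ r ∈ Ioc R (2 * R), ∑ t ∈ Ioc A B, ‖jtInner D₁ D₂ γ' r t‖ ^ 2 ≤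
        C * jtBnd ε D₁ D₂ R B * jtNormSq D₁ D₂ γ' := by
  obtain ⟨C₁, hC₁0, hC₁⟩ := exists_jtW_le_jtBnd hε hε1
  refine ⟨2 * C₁ + 2, by positivity, fun D₁ D₂ R A B γ' hR hγ hD₂ hAB hBA => ?_⟩
  have hγ0 : 0 ≤ jtNormSq D₁ D₂ γ' := jtNormSq_nonneg _ _ _
  have hB0 : (0 : ℝ) ≤ B := Nat.cast_nonneg B
  have hbnd0 : 0 ≤ jtBnd ε D₁ D₂ R B := jtBnd_nonneg D₁ D₂ R hB0
  have hR1 : (1 : ℝ) ≤ R := by exact_mod_cast hR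
  rcases Nat.eq_zero_or_pos A with hA0 | hA
  · -- `A = 0`, `B ≤ 1`
    subst hA0
    have hB1 : B ≤ 1 := by omega
    interval_cases B
    · rw [show Ioc 0 0 = (∅ : Finset ℕ) by rfl]
      simp only [sum_empty, sum_const_zero]
      positivity
    · -- the single slice `t = 1`
      rw [show Ioc 0 1 = ({1} : Finset ℕ) by rfl]
      simp only [sum_singleton]
      refine (sum_norm_jtInner_sq_le_trivial hγ R 1).trans ?_
      -- `(D₂ - D₁)(R/(D₁+1) + 1) ≤ 2R + D₂ ≤ 2 jtBnd(1)`
      rcases Nat.eq_zero_or_pos D₂ with hD0 | hD₂pos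
      · subst hD0
        simp only [Nat.zero_sub, Nat.cast_zero, zero_mul]
        exact mul_nonneg (mul_nonneg (by positivity) hbnd0) hγ0
      have hD1 : (1 : ℝ) ≤ D₂ := by exact_mod_cast hD₂pos
      have hsub : ((D₂ - D₁ : ℕ) : ℝ) ≤ D₂ := by exact_mod_cast Nat.sub_le D₂ D₁
      have hD₂' : (D₂ : ℝ) ≤ 2 * ((D₁ : ℝ) + 1) := by exact_mod_cast hD₂
      have htriv : ((D₂ - D₁ : ℕ) : ℝ) * ((R : ℝ) / (D₁ + 1) + 1) ≤ 2 * R + D₂ := by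
        have hD₁0 : (0 : ℝ) < (D₁ : ℝ) + 1 := by positivity
        calc ((D₂ - D₁ : ℕ) : ℝ) * ((R : ℝ) / (D₁ + 1) + 1) ≤ (D₂ : ℝ) * ((R : ℝ) / (D₁ + 1) + 1) :=
              mul_le_mul_of_nonneg_right hsub (by positivity)
          _ = (D₂ : ℝ) / ((D₁ : ℝ) + 1) * R + D₂ := by ring
          _ ≤ 2 * R + D₂ := by
              refine add_le_add (mul_le_mul_of_nonneg_right ?_ (by positivity)) le_rfl
              rw [div_le_iff₀ hD₁0]; exact hD₂'
      have hbnd1 : (R : ℝ) + D₂ ≤ jtBnd ε D₁ D₂ R (1 : ℕ) := by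
        rw [jtBnd_def, Nat.cast_one, mul_one, mul_one]
        have hP : 1 ≤ ((D₂ : ℝ) * R) ^ ε := Real.one_le_rpow (by nlinarith) hε.le
        have hsq : 1 ≤ Real.sqrt (R : ℝ) := by rw [Real.le_sqrt (by norm_num) (by positivity)]; simpa using hR1
        have h1 : (R : ℝ) + D₂ ≤ (1 * (R : ℝ) ^ (3 / 4 : ℝ) + (R : ℝ) * (1 : ℝ) ^ (3 / 4 : ℝ) +
            D₂ * Real.sqrt (R : ℝ)) := by
          rw [Real.one_rpow, mul_one]
          have : (D₂ : ℝ) ≤ D₂ * Real.sqrt R := by nlinarith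
          have : 0 ≤ 1 * (R : ℝ) ^ (3 / 4 : ℝ) := by positivity
          linarith
        have h2 : 0 ≤ (R : ℝ) * Real.sqrt D₂ / (D₁ + 1) := by positivity
        calc (R : ℝ) + D₂ ≤ (1 * (R : ℝ) ^ (3 / 4 : ℝ) + (R : ℝ) * (1 : ℝ) ^ (3 / 4 : ℝ) +
            D₂ * Real.sqrt (R : ℝ)) * 1 := by rw [mul_one]; exact h1
          _ ≤ (1 * (R : ℝ) ^ (3 / 4 : ℝ) + (R : ℝ) * (1 : ℝ) ^ (3 / 4 : ℝ) +
            D₂ * Real.sqrt (R : ℝ)) * ((D₂ : ℝ) * R) ^ ε := mul_le_mul_of_nonneg_left hP (by positivity)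
          _ ≤ _ := by linarith
      calc ((D₂ - D₁ : ℕ) : ℝ) * ((R : ℝ) / (D₁ + 1) + 1) * jtNormSq D₁ D₂ γ'
          ≤ (2 * R + D₂) * jtNormSq D₁ D₂ γ' := mul_le_mul_of_nonneg_right htriv hγ0
        _ ≤ (2 * jtBnd ε D₁ D₂ R (1 : ℕ)) * jtNormSq D₁ D₂ γ' :=
            mul_le_mul_of_nonneg_right (by linarith) hγ0
        _ ≤ (2 * C₁ + 2) * jtBnd ε D₁ D₂ R (1 : ℕ) * jtNormSq D₁ D₂ γ' := by
            have : 0 ≤ jtBnd ε D₁ D₂ R (1 : ℕ) * jtNormSq D₁ D₂ γ' := mul_nonneg (by linarith) hγ0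
            nlinarith
  · -- `A ≥ 1`: two dyadic ranges
    have hsub : Ioc A B ⊆ Ioc A (2 * A) ∪ Ioc (A + 1) (2 * (A + 1)) := by
      intro t ht
      rw [mem_Ioc] at ht
      rw [mem_union, mem_Ioc, mem_Ioc]
      omega
    have hle : ∀ r : ℕ, ∑ t ∈ Ioc A B, ‖jtInner D₁ D₂ γ' r t‖ ^ 2 ≤
        ∑ t ∈ Ioc A (2 * A), ‖jtInner D₁ D₂ γ' r t‖ ^ 2 +
          ∑ t ∈ Ioc (A + 1) (2 * (A + 1)), ‖jtInner D₁ D₂ γ' r t‖ ^ 2 := by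
      intro r
      refine (sum_le_sum_of_subset_of_nonneg hsub fun _ _ _ => by positivity).trans ?_
      rw [← sum_union_inter]
      have : 0 ≤ ∑ t ∈ Ioc A (2 * A) ∩ Ioc (A + 1) (2 * (A + 1)), ‖jtInner D₁ D₂ γ' r t‖ ^ 2 :=
        sum_nonneg fun _ _ => by positivity
      linarith
    have hA1 : 1 ≤ A := hA
    have hW1 := hC₁ D₁ D₂ R A γ' hR hA1 hγ
    have hW2 := hC₁ D₁ D₂ R (A + 1) γ' hR (by omega) hγ
    rw [jtW_eq_sum_jtInner] at hW1 hW2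
    have hm1 : jtBnd ε D₁ D₂ R A ≤ jtBnd ε D₁ D₂ R B :=
      jtBnd_mono hε.le D₁ D₂ R (Nat.cast_nonneg A) (by exact_mod_cast (by omega : A ≤ B))
    have hm2 : jtBnd ε D₁ D₂ R (A + 1 : ℕ) ≤ jtBnd ε D₁ D₂ R B :=
      jtBnd_mono hε.le D₁ D₂ R (Nat.cast_nonneg _) (by exact_mod_cast (by omega : A + 1 ≤ B))
    calc ∑ r ∈ Ioc R (2 * R), ∑ t ∈ Ioc A B, ‖jtInner D₁ D₂ γ' r t‖ ^ 2
        ≤ ∑ r ∈ Ioc R (2 * R), ∑ t ∈ Ioc A (2 * A), ‖jtInner D₁ D₂ γ' r t‖ ^ 2 +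
          ∑ r ∈ Ioc R (2 * R), ∑ t ∈ Ioc (A + 1) (2 * (A + 1)), ‖jtInner D₁ D₂ γ' r t‖ ^ 2 := by
          rw [← sum_add_distrib]; exact sum_le_sum fun r _ => hle r
      _ ≤ C₁ * jtBnd ε D₁ D₂ R A * jtNormSq D₁ D₂ γ' + C₁ * jtBnd ε D₁ D₂ R (A + 1 : ℕ) * jtNormSq D₁ D₂ γ' :=
          add_le_add hW1 (by exact_mod_cast hW2)
      _ ≤ C₁ * jtBnd ε D₁ D₂ R B * jtNormSq D₁ D₂ γ' + C₁ * jtBnd ε D₁ D₂ R B * jtNormSq D₁ D₂ γ' := by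
          gcongr
      _ ≤ (2 * C₁ + 2) * jtBnd ε D₁ D₂ R B * jtNormSq D₁ D₂ γ' := by
          have : 0 ≤ jtBnd ε D₁ D₂ R B * jtNormSq D₁ D₂ γ' := mul_nonneg hbnd0 hγ0
          nlinarith




/-- `(2D)/e ≤ 2 (D/e) + 1`. [folklore] -/
theorem two_mul_div_le (D : ℕ) {e : ℕ} (he : 0 < e) : 2 * D / e ≤ 2 * (D / e) + 1 := by
  have h1 : 2 * D / e < 2 * (D / e) + 2 := by
    rw [Nat.div_lt_iff_lt_mul he]
    have := Nat.div_add_mod D e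
    have := Nat.mod_lt D he
    nlinarith
  omega

/-- **The `(e, f)`-piece of the removal step:** for `D, R, S, e, f ≥ 1` and any `γ`,
`∑_r ∑_{S<s≤2S, e∣s, f∣s} |Z^{(e)}(r, s/e)|² ≤ C · jtBnd(D/e, 2D/e, R, ⌊2S/[e,f]⌋) ‖γ^{(e)}‖²`
(reindex `s = [e,f] t`, dilate by `[e,f]/e`, and apply `exists_piece_le`).
[cite: FriedlanderIwaniecAnnals1998, §11, end of the proof of (11.19)] -/
theorem exists_ef_piece_le {ε : ℝ} (hε : 0 < ε) (hε1 : ε ≤ 1) :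
    ∃ C : ℝ, 0 < C ∧ ∀ (D R S e f : ℕ) (γ : ℕ → ℕ → ℂ), 1 ≤ R → 1 ≤ e → 1 ≤ f →
      ∑ r ∈ Ioc R (2 * R), ∑ s ∈ (Ioc S (2 * S)).filter (fun s => e ∣ s ∧ f ∣ s),
        ‖jtInner (D / e) (2 * D / e) (jtPull γ e) r (s / e)‖ ^ 2 ≤
        C * jtBnd ε (D / e) (2 * D / e) R ((2 * S / Nat.lcm e f : ℕ) : ℝ) *
          jtNormSq (D / e) (2 * D / e) (jtPull γ e) := by
  obtain ⟨C, hC0, hC⟩ := exists_piece_le hε hε1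
  refine ⟨C, hC0, fun D R S e f γ hR he hf => ?_⟩
  set l := Nat.lcm e f with hl
  have hl0 : 0 < l := Nat.lcm_pos he hf
  set γ' := jtDilate (jtPull γ e) (l / e) with hγ'
  have hunit : IsUnitSupported (D / e) (2 * D / e) γ' :=
    isUnitSupported_jtDilate (isUnitSupported_jtPull _ _ γ e) _
  have h1 : ∑ r ∈ Ioc R (2 * R), ∑ s ∈ (Ioc S (2 * S)).filter (fun s => e ∣ s ∧ f ∣ s),
      ‖jtInner (D / e) (2 * D / e) (jtPull γ e) r (s / e)‖ ^ 2 =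
      ∑ r ∈ Ioc R (2 * R), ∑ t ∈ Ioc (S / l) (2 * S / l), ‖jtInner (D / e) (2 * D / e) γ' r t‖ ^ 2 := by
    refine sum_congr rfl fun r _ => ?_
    rw [sum_filter_dvd_dvd_eq_sum_lcm he hf S (fun u => ‖jtInner (D / e) (2 * D / e) (jtPull γ e) r u‖ ^ 2)]
    refine sum_congr rfl fun t _ => ?_
    rw [hγ', jtInner_mul_eq_jtInner_jtDilate]
  rw [h1]
  have h2 := hC (D / e) (2 * D / e) R (S / l) (2 * S / l) γ' hR hunit
    (by have := two_mul_div_le D he; omega) (Nat.mul_div_le_mul_div_assoc 2 S l) (two_mul_div_le S hl0)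
  refine h2.trans (mul_le_mul_of_nonneg_left (jtNormSq_jtDilate_le (isUnitSupported_jtPull _ _ γ e) _) ?_)
  exact mul_nonneg hC0.le (jtBnd_nonneg _ _ _ (Nat.cast_nonneg _))




/-! ### W8: the convergent `f`-series and the `e`-factors -/

/-- `∑_{m=1}^N m^{-1-κ} ≤ 1 + 1/κ` for `κ > 0`. [folklore] -/
theorem sum_Icc_rpow_neg_le (N : ℕ) {κ : ℝ} (hκ : 0 < κ) :
    ∑ m ∈ Icc 1 N, (m : ℝ) ^ (-1 - κ) ≤ 1 + 1 / κ := by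
  rcases Nat.eq_zero_or_pos N with hN | hN
  · subst hN; simp; positivity
  have hsplit : ∑ m ∈ Icc 1 N, (m : ℝ) ^ (-1 - κ) = 1 + ∑ i ∈ Ico 1 N, ((i + 1 : ℕ) : ℝ) ^ (-1 - κ) := by
    rw [show Icc 1 N = insert 1 (Icc 2 N) by ext m; simp only [mem_insert, mem_Icc]; omega,
      sum_insert (by simp)]
    simp only [Nat.cast_one, Real.one_rpow]
    congr 1
    refine sum_nbij' (fun m => m - 1) (fun i => i + 1) ?_ ?_ ?_ ?_ ?_
    · intro m hm; rw [mem_Icc] at hm; rw [mem_Ico]; omega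
    · intro i hi; rw [mem_Ico] at hi; rw [mem_Icc]; omega
    · intro m hm; rw [mem_Icc] at hm; omega
    · intro i _; omega
    · intro m hm; rw [mem_Icc] at hm; congr; omega
  rw [hsplit]
  have hanti : AntitoneOn (fun x : ℝ => x ^ (-1 - κ)) (Set.Icc ((1 : ℕ) : ℝ) (N : ℕ)) := by
    intro x hx y _ hxy
    have hx1 : (1 : ℝ) ≤ x := by simpa using hx.1
    exact Real.rpow_le_rpow_of_nonpos (by linarith) hxy (by linarith)
  have hint := AntitoneOn.sum_le_integral_Ico (a := 1) (b := N) hN hanti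
  have hN1 : (1 : ℝ) ≤ N := by exact_mod_cast hN
  have hval : ∫ x in ((1 : ℕ) : ℝ)..(N : ℕ), x ^ (-1 - κ) ≤ 1 / κ := by
    rw [integral_rpow (Or.inr ⟨by linarith, by
      rw [Set.mem_uIcc]; push_cast; intro h; rcases h with h | h <;> linarith⟩)]
    push_cast
    rw [show -1 - κ + 1 = -κ by ring, Real.one_rpow]
    have hNk : 0 ≤ (N : ℝ) ^ (-κ) := by positivity
    have he : ((N : ℝ) ^ (-κ) - 1) / (-κ) = (1 - (N : ℝ) ^ (-κ)) / κ := by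
      rw [div_neg, ← neg_div, neg_sub]
    rw [he]
    exact div_le_div_of_nonneg_right (by linarith) hκ.le
  have hchain := hint.trans hval
  linarith

/-- **The `f`-series:** for `κ > 0`, `θ ≤ 1 + κ` and `e ≥ 1`,
`∑_{f ≤ N} (e, f)^θ f^{-1-κ} ≤ τ(e) (1 + 1/κ)` (group by `g = (e, f) ∣ e`, `f = g m`).
[folklore] -/
theorem sum_gcd_rpow_mul_rpow_le (N : ℕ) {e : ℕ} (he : 0 < e) {κ θ : ℝ} (hκ : 0 < κ) (hθ : θ ≤ 1 + κ) :
    ∑ f ∈ Icc 1 N, ((Nat.gcd e f : ℕ) : ℝ) ^ θ * (f : ℝ) ^ (-1 - κ) ≤ (σ 0 e : ℝ) * (1 + 1 / κ) := by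
  -- replace `gcd^θ` by the sum over all common divisors `g ∣ e`, `g ∣ f`
  have h1 : ∀ f ∈ Icc 1 N, ((Nat.gcd e f : ℕ) : ℝ) ^ θ * (f : ℝ) ^ (-1 - κ) ≤
      ∑ g ∈ e.divisors, (if g ∣ f then (g : ℝ) ^ θ * (f : ℝ) ^ (-1 - κ) else 0) := by
    intro f hf
    have hf0 : 0 < f := (mem_Icc.mp hf).1
    have hmem : Nat.gcd e f ∈ e.divisors := Nat.mem_divisors.mpr ⟨Nat.gcd_dvd_left e f, he.ne'⟩
    rw [← sum_filter]
    refine single_le_sum (f := fun g : ℕ => (g : ℝ) ^ θ * (f : ℝ) ^ (-1 - κ))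
      (fun g _ => mul_nonneg (Real.rpow_nonneg (Nat.cast_nonneg _) _) (Real.rpow_nonneg (Nat.cast_nonneg _) _)) ?_
    rw [mem_filter]; exact ⟨hmem, Nat.gcd_dvd_right e f⟩
  refine (sum_le_sum h1).trans ?_
  rw [sum_comm]
  -- for each `g ∣ e`: `∑_{f ≤ N, g ∣ f} g^θ f^{-1-κ} ≤ 1 + 1/κ`
  have h2 : ∀ g ∈ e.divisors, ∑ f ∈ Icc 1 N, (if g ∣ f then (g : ℝ) ^ θ * (f : ℝ) ^ (-1 - κ) else 0) ≤
      1 + 1 / κ := by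
    intro g hg
    have hg0 : 0 < g := Nat.pos_of_mem_divisors hg
    have hg1 : (1 : ℝ) ≤ g := by exact_mod_cast hg0
    rw [← sum_filter]
    -- reindex `f = g m`, `m ≤ N / g ≤ N`
    have h3 : ∑ f ∈ (Icc 1 N).filter (fun f => g ∣ f), (g : ℝ) ^ θ * (f : ℝ) ^ (-1 - κ) ≤
        ∑ m ∈ Icc 1 N, (g : ℝ) ^ θ * ((g : ℝ) * m) ^ (-1 - κ) := by
      rw [show (Icc 1 N).filter (fun f => g ∣ f) = (Icc 1 (N / g)).image (fun m => g * m) by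
        ext f
        simp only [mem_filter, mem_Icc, mem_image]
        constructor
        · rintro ⟨⟨h1f, h2f⟩, ⟨m, rfl⟩⟩
          refine ⟨m, ⟨?_, ?_⟩, rfl⟩
          · rcases Nat.eq_zero_or_pos m with hm | hm
            · subst hm; omega
            · exact hm
          · exact (Nat.le_div_iff_mul_le hg0).mpr (by rw [mul_comm]; exact h2f)
        · rintro ⟨m, ⟨h1m, h2m⟩, rfl⟩
          refine ⟨⟨Nat.mul_pos hg0 (by omega), ?_⟩, dvd_mul_right g m⟩
          calc g * m ≤ g * (N / g) := Nat.mul_le_mul_left g h2m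
            _ ≤ N := Nat.mul_div_le N g]
      rw [sum_image (fun m _ m' _ h => Nat.eq_of_mul_eq_mul_left hg0 h)]
      push_cast
      exact sum_le_sum_of_subset_of_nonneg (Icc_subset_Icc_right (Nat.div_le_self N g))
        fun _ _ _ => by positivity
    refine h3.trans ?_
    have h4 : ∀ m ∈ Icc 1 N, (g : ℝ) ^ θ * ((g : ℝ) * m) ^ (-1 - κ) ≤ (m : ℝ) ^ (-1 - κ) := by
      intro m hm
      have hm0 : (0 : ℝ) ≤ m := Nat.cast_nonneg m
      rw [Real.mul_rpow (by positivity) hm0, ← mul_assoc, ← Real.rpow_add (by positivity)]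
      have : (g : ℝ) ^ (θ + (-1 - κ)) ≤ 1 := Real.rpow_le_one_of_one_le_of_nonpos hg1 (by linarith)
      calc (g : ℝ) ^ (θ + (-1 - κ)) * (m : ℝ) ^ (-1 - κ) ≤ 1 * (m : ℝ) ^ (-1 - κ) :=
            mul_le_mul_of_nonneg_right this (by positivity)
        _ = _ := one_mul _
    exact (sum_le_sum h4).trans (sum_Icc_rpow_neg_le N hκ)
  calc ∑ g ∈ e.divisors, ∑ f ∈ Icc 1 N, (if g ∣ f then (g : ℝ) ^ θ * (f : ℝ) ^ (-1 - κ) else 0)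
      ≤ ∑ g ∈ e.divisors, (1 + 1 / κ) := sum_le_sum h2
    _ = (σ 0 e : ℝ) * (1 + 1 / κ) := by
        rw [sum_const, nsmul_eq_mul, ArithmeticFunction.sigma_zero_apply]

/-- **The `e`-factors are bounded:** `τ(e)² e^{-κ} ≤ C(κ)` for `κ > 0`. [folklore] -/
theorem exists_sigma_zero_sq_mul_rpow_le {κ : ℝ} (hκ : 0 < κ) :
    ∃ C : ℝ, 0 < C ∧ ∀ e : ℕ, 1 ≤ e → (σ 0 e : ℝ) ^ 2 * (e : ℝ) ^ (-κ) ≤ C := by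
  obtain ⟨Cd, hCd1, hCd⟩ := exists_sigma_zero_le_mul_rpow (half_pos hκ)
  refine ⟨Cd ^ 2, by positivity, fun e he => ?_⟩
  have he0 : (0 : ℝ) < e := by exact_mod_cast he
  have h := hCd e
  calc (σ 0 e : ℝ) ^ 2 * (e : ℝ) ^ (-κ) ≤ (Cd * (e : ℝ) ^ (κ / 2)) ^ 2 * (e : ℝ) ^ (-κ) := by
        gcongr
    _ = Cd ^ 2 := by
        rw [mul_pow, ← Real.rpow_natCast ((e : ℝ) ^ (κ / 2)), ← Real.rpow_mul he0.le, mul_assoc,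
          ← Real.rpow_add he0]
        norm_num




/-! ### W8: the `(e, f)`-weights against `jtBnd` -/

/-- Monotone majorant of `jtBnd` in the level parameters and the scale. [folklore] -/
theorem jtBnd_le_of_le {ε : ℝ} (hε : 0 ≤ ε) {D₁ D₂ R : ℕ} {B y Δ₂ δ₁ : ℝ} (hB : 0 ≤ B) (hBy : B ≤ y)
    (hD₂ : (D₂ : ℝ) ≤ Δ₂) (hδ₁ : 0 < δ₁) (hδ : δ₁ ≤ (D₁ : ℝ) + 1) :
    jtBnd ε D₁ D₂ R B ≤ (R : ℝ) * y * Real.sqrt Δ₂ / δ₁ +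
      (y * (R : ℝ) ^ (3 / 4 : ℝ) + (R : ℝ) * y ^ (3 / 4 : ℝ) + Δ₂ * Real.sqrt ((R : ℝ) * y)) * (Δ₂ * R * y) ^ ε := by
  rw [jtBnd_def]
  have hy : 0 ≤ y := hB.trans hBy
  have hR : (0 : ℝ) ≤ R := Nat.cast_nonneg R
  have hD : (0 : ℝ) ≤ D₂ := Nat.cast_nonneg D₂
  have hΔ : 0 ≤ Δ₂ := hD.trans hD₂
  have h1 : (R : ℝ) * B * Real.sqrt D₂ / (D₁ + 1) ≤ (R : ℝ) * y * Real.sqrt Δ₂ / δ₁ := by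
    calc (R : ℝ) * B * Real.sqrt D₂ / (D₁ + 1) ≤ (R : ℝ) * y * Real.sqrt Δ₂ / (D₁ + 1) := by
          refine div_le_div_of_nonneg_right ?_ (by positivity)
          exact mul_le_mul (mul_le_mul_of_nonneg_left hBy hR) (Real.sqrt_le_sqrt hD₂) (Real.sqrt_nonneg _)
            (by positivity)
      _ ≤ (R : ℝ) * y * Real.sqrt Δ₂ / δ₁ :=
          div_le_div_of_nonneg_left (by positivity) hδ₁ hδ
  have h2 : B * (R : ℝ) ^ (3 / 4 : ℝ) + (R : ℝ) * B ^ (3 / 4 : ℝ) + D₂ * Real.sqrt ((R : ℝ) * B) ≤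
      y * (R : ℝ) ^ (3 / 4 : ℝ) + (R : ℝ) * y ^ (3 / 4 : ℝ) + Δ₂ * Real.sqrt ((R : ℝ) * y) := by
    refine add_le_add (add_le_add ?_ ?_) ?_
    · exact mul_le_mul_of_nonneg_right hBy (by positivity)
    · exact mul_le_mul_of_nonneg_left (Real.rpow_le_rpow hB hBy (by norm_num)) hR
    · exact mul_le_mul hD₂ (Real.sqrt_le_sqrt (mul_le_mul_of_nonneg_left hBy hR)) (Real.sqrt_nonneg _) hΔ
  have h3 : ((D₂ : ℝ) * R * B) ^ ε ≤ (Δ₂ * R * y) ^ ε :=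
    Real.rpow_le_rpow (by positivity) (mul_le_mul (mul_le_mul_of_nonneg_right hD₂ hR) hBy hB (by positivity)) hε
  exact add_le_add h1 (mul_le_mul h2 h3 (by positivity) (by positivity))




/-- `2 √2 ≤ 3`. [folklore] -/
theorem two_mul_sqrt_two_le_three : (2 : ℝ) * Real.sqrt 2 ≤ 3 := by
  nlinarith [Real.sq_sqrt (show (0 : ℝ) ≤ 2 by norm_num), Real.sqrt_nonneg 2]

set_option maxHeartbeats 800000 in
/-- **The `(e, f)`-weights against the majorant of `jtBnd`** (pure algebra): with
`y = 2Sg/(ef)`, `Δ₂ = 2D/e`, `δ₁ = D/e`, `1 ≤ g ≤ e`, `w = e^α f^{-α}`, `E = e^α √e / e`,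
`w · {R y √Δ₂/δ₁ + (y R^{3/4} + R y^{3/4} + Δ₂ √(Ry)) (Δ₂ R y)^ε}
 ≤ 3 g E {RS/√D · f^{-α}/f + (S R^{3/4} f^{-α}/f + R S^{3/4} f^{-α} f^{-3/4} + D √(RS) f^{-α} (√f)⁻¹ f^{-ε}) (4DRS)^ε}`.
[folklore] -/
theorem ef_weights_le {ε α : ℝ} (hε : 0 < ε) {D R S e f g : ℝ} (hD : 1 ≤ D) (hR : 1 ≤ R)
    (hS : 1 ≤ S) (he : 1 ≤ e) (hf : 1 ≤ f) (hg : 1 ≤ g) (hge : g ≤ e) :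
    e ^ α * f ^ (-α) * (R * (2 * S * g / (e * f)) * Real.sqrt (2 * D / e) / (D / e) +
      ((2 * S * g / (e * f)) * R ^ (3 / 4 : ℝ) + R * (2 * S * g / (e * f)) ^ (3 / 4 : ℝ) +
        (2 * D / e) * Real.sqrt (R * (2 * S * g / (e * f)))) * ((2 * D / e) * R * (2 * S * g / (e * f))) ^ ε) ≤
    3 * g * (e ^ α * Real.sqrt e / e) *
      (R * S / Real.sqrt D * (f ^ (-α) / f) +
        (S * R ^ (3 / 4 : ℝ) * (f ^ (-α) / f) + R * S ^ (3 / 4 : ℝ) * (f ^ (-α) * f ^ (-(3 / 4 : ℝ))) +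
          D * Real.sqrt (R * S) * (f ^ (-α) * (Real.sqrt f)⁻¹ * f ^ (-ε))) * (4 * D * R * S) ^ ε) := by
  have he0 : 0 < e := by linarith
  have hf0 : 0 < f := by linarith
  have hg0 : 0 < g := by linarith
  have hD0 : 0 < D := by linarith
  have hR0 : 0 < R := by linarith
  have hS0 : 0 < S := by linarith
  have hsqe : 0 < Real.sqrt e := Real.sqrt_pos.mpr he0
  have hsqf : 0 < Real.sqrt f := Real.sqrt_pos.mpr hf0
  have hsqD : 0 < Real.sqrt D := Real.sqrt_pos.mpr hD0
  have hsqe1 : 1 ≤ Real.sqrt e := by rw [Real.le_sqrt (by norm_num) he0.le]; simpa using he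
  have hsqf1 : 1 ≤ Real.sqrt f := by rw [Real.le_sqrt (by norm_num) hf0.le]; simpa using hf
  have heα : 0 < e ^ α := Real.rpow_pos_of_pos he0 α
  have hfα : 0 < f ^ (-α) := Real.rpow_pos_of_pos hf0 _
  set y : ℝ := 2 * S * g / (e * f) with hy
  have hy0 : 0 < y := by positivity
  set E : ℝ := e ^ α * Real.sqrt e / e with hE
  have hE0 : 0 < E := by positivity
  set P : ℝ := (4 * D * R * S) ^ ε with hP
  have hP1 : 1 ≤ P := Real.one_le_rpow (by nlinarith [mul_nonneg (by linarith : (0:ℝ) ≤ D) (by linarith : (0:ℝ) ≤ R)]) hε.le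
  -- the `ε`-power
  have hPf : ((2 * D / e) * R * y) ^ ε ≤ P * f ^ (-ε) := by
    have h1 : (2 * D / e) * R * y ≤ 4 * D * R * S * f⁻¹ := by
      rw [hy]
      have : (2 * D / e) * R * (2 * S * g / (e * f)) = 4 * D * R * S * f⁻¹ * (g / (e * e)) := by
        field_simp
        norm_num
      rw [this]
      have hge2 : g / (e * e) ≤ 1 := by
        rw [div_le_one (by positivity)]; nlinarith
      calc 4 * D * R * S * f⁻¹ * (g / (e * e)) ≤ 4 * D * R * S * f⁻¹ * 1 :=
            mul_le_mul_of_nonneg_left hge2 (by positivity)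
        _ = _ := mul_one _
    calc ((2 * D / e) * R * y) ^ ε ≤ (4 * D * R * S * f⁻¹) ^ ε := Real.rpow_le_rpow (by positivity) h1 hε.le
      _ = P * f ^ (-ε) := by rw [Real.mul_rpow (by positivity) (by positivity), Real.rpow_neg hf0.le, Real.inv_rpow hf0.le]
  have hfε1 : f ^ (-ε) ≤ 1 := Real.rpow_le_one_of_one_le_of_nonpos hf (by linarith)
  have hPf' : ((2 * D / e) * R * y) ^ ε ≤ P := hPf.trans (by nlinarith [mul_le_mul_of_nonneg_left hfε1 (by linarith : (0:ℝ) ≤ P)])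
  -- useful `e`-facts
  have hEe1 : e ^ α / e ≤ E := by
    rw [hE]; refine div_le_div_of_nonneg_right ?_ he0.le
    calc e ^ α = e ^ α * 1 := (mul_one _).symm
      _ ≤ e ^ α * Real.sqrt e := mul_le_mul_of_nonneg_left hsqe1 heα.le
  have hsqee : Real.sqrt e / e = (Real.sqrt e)⁻¹ := by
    rw [Real.sqrt_div_self', one_div]
  have hEe2 : e ^ α / Real.sqrt e = E := by
    rw [hE, mul_div_assoc, hsqee, div_eq_mul_inv]
  have hEe3 : e ^ α / (e * Real.sqrt e) ≤ E := by
    rw [← hEe2]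
    refine div_le_div_of_nonneg_left heα.le hsqe ?_
    calc Real.sqrt e = 1 * Real.sqrt e := (one_mul _).symm
      _ ≤ e * Real.sqrt e := mul_le_mul_of_nonneg_right he hsqe.le
  -- term 1
  have hsq1 : Real.sqrt (2 * D / e) / (D / e) = Real.sqrt 2 * Real.sqrt e / Real.sqrt D := by
    rw [Real.sqrt_div' _ he0.le, Real.sqrt_mul' _ hD0.le]
    field_simp
    rw [Real.sq_sqrt hD0.le, Real.sq_sqrt he0.le]; ring
  have h1 : e ^ α * f ^ (-α) * (R * y * Real.sqrt (2 * D / e) / (D / e)) ≤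
      3 * g * E * (R * S / Real.sqrt D * (f ^ (-α) / f)) := by
    have heq : e ^ α * f ^ (-α) * (R * y * Real.sqrt (2 * D / e) / (D / e)) =
        (2 * Real.sqrt 2) * (g * E * (R * S / Real.sqrt D * (f ^ (-α) / f))) := by
      rw [mul_div_assoc (R * y), hsq1, hy, hE]
      field_simp
    rw [heq]
    have h0 : 0 ≤ g * E * (R * S / Real.sqrt D * (f ^ (-α) / f)) := by positivity
    calc (2 * Real.sqrt 2) * (g * E * (R * S / Real.sqrt D * (f ^ (-α) / f)))
        ≤ 3 * (g * E * (R * S / Real.sqrt D * (f ^ (-α) / f))) :=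
          mul_le_mul_of_nonneg_right two_mul_sqrt_two_le_three h0
      _ = _ := by ring
  -- term 2
  have h2 : e ^ α * f ^ (-α) * (y * R ^ (3 / 4 : ℝ)) * ((2 * D / e) * R * y) ^ ε ≤
      3 * g * E * (S * R ^ (3 / 4 : ℝ) * (f ^ (-α) / f)) * P := by
    have heq : e ^ α * f ^ (-α) * (y * R ^ (3 / 4 : ℝ)) = 2 * (g * (e ^ α / e) * (S * R ^ (3 / 4 : ℝ) * (f ^ (-α) / f))) := by
      rw [hy]; field_simp
    rw [heq]
    have h0 : 0 ≤ g * (e ^ α / e) * (S * R ^ (3 / 4 : ℝ) * (f ^ (-α) / f)) := by positivity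
    have hX : g * (e ^ α / e) * (S * R ^ (3 / 4 : ℝ) * (f ^ (-α) / f)) ≤
        g * E * (S * R ^ (3 / 4 : ℝ) * (f ^ (-α) / f)) :=
      mul_le_mul_of_nonneg_right (mul_le_mul_of_nonneg_left hEe1 hg0.le) (by positivity)
    calc 2 * (g * (e ^ α / e) * (S * R ^ (3 / 4 : ℝ) * (f ^ (-α) / f))) * ((2 * D / e) * R * y) ^ ε
        ≤ 2 * (g * E * (S * R ^ (3 / 4 : ℝ) * (f ^ (-α) / f))) * P :=
          mul_le_mul (mul_le_mul_of_nonneg_left hX (by norm_num)) hPf' (by positivity) (by positivity)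
      _ ≤ 3 * (g * E * (S * R ^ (3 / 4 : ℝ) * (f ^ (-α) / f))) * P := by
          have : 0 ≤ g * E * (S * R ^ (3 / 4 : ℝ) * (f ^ (-α) / f)) * P := by positivity
          nlinarith
      _ = _ := by ring
  -- term 3
  have hy34 : y ^ (3 / 4 : ℝ) ≤ 2 * S ^ (3 / 4 : ℝ) * g * (Real.sqrt e)⁻¹ * f ^ (-(3 / 4 : ℝ)) := by
    rw [hy, Real.div_rpow (by positivity) (by positivity), Real.mul_rpow (by positivity) hg0.le,
      Real.mul_rpow (by norm_num) hS0.le, Real.mul_rpow he0.le hf0.le]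
    have h2 : (2 : ℝ) ^ (3 / 4 : ℝ) ≤ 2 := by
      calc (2 : ℝ) ^ (3 / 4 : ℝ) ≤ (2 : ℝ) ^ (1 : ℝ) := Real.rpow_le_rpow_of_exponent_le (by norm_num) (by norm_num)
        _ = 2 := Real.rpow_one 2
    have hg34 : g ^ (3 / 4 : ℝ) ≤ g := by
      calc g ^ (3 / 4 : ℝ) ≤ g ^ (1 : ℝ) := Real.rpow_le_rpow_of_exponent_le hg (by norm_num)
        _ = g := Real.rpow_one g
    have he34 : (e ^ (3 / 4 : ℝ))⁻¹ ≤ (Real.sqrt e)⁻¹ := by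
      rw [Real.sqrt_eq_rpow]
      refine inv_anti₀ (Real.rpow_pos_of_pos he0 _) (Real.rpow_le_rpow_of_exponent_le he (by norm_num))
    have hf34 : (f ^ (3 / 4 : ℝ))⁻¹ = f ^ (-(3 / 4 : ℝ)) := (Real.rpow_neg hf0.le _).symm
    rw [div_eq_mul_inv, mul_inv, ← hf34]
    have hA : (2 : ℝ) ^ (3 / 4 : ℝ) * S ^ (3 / 4 : ℝ) * g ^ (3 / 4 : ℝ) ≤ 2 * S ^ (3 / 4 : ℝ) * g :=
      mul_le_mul (mul_le_mul_of_nonneg_right h2 (by positivity)) hg34 (by positivity) (by positivity)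
    have hB : (e ^ (3 / 4 : ℝ))⁻¹ * (f ^ (3 / 4 : ℝ))⁻¹ ≤ (Real.sqrt e)⁻¹ * (f ^ (3 / 4 : ℝ))⁻¹ :=
      mul_le_mul_of_nonneg_right he34 (by positivity)
    calc (2 : ℝ) ^ (3 / 4 : ℝ) * S ^ (3 / 4 : ℝ) * g ^ (3 / 4 : ℝ) * ((e ^ (3 / 4 : ℝ))⁻¹ * (f ^ (3 / 4 : ℝ))⁻¹)
        ≤ 2 * S ^ (3 / 4 : ℝ) * g * ((Real.sqrt e)⁻¹ * (f ^ (3 / 4 : ℝ))⁻¹) :=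
          mul_le_mul hA hB (by positivity) (by positivity)
      _ = _ := by ring
  have h3 : e ^ α * f ^ (-α) * (R * y ^ (3 / 4 : ℝ)) * ((2 * D / e) * R * y) ^ ε ≤
      3 * g * E * (R * S ^ (3 / 4 : ℝ) * (f ^ (-α) * f ^ (-(3 / 4 : ℝ)))) * P := by
    have hX : e ^ α * f ^ (-α) * (R * y ^ (3 / 4 : ℝ)) ≤
        2 * (g * E * (R * S ^ (3 / 4 : ℝ) * (f ^ (-α) * f ^ (-(3 / 4 : ℝ))))) := by
      calc e ^ α * f ^ (-α) * (R * y ^ (3 / 4 : ℝ))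
          ≤ e ^ α * f ^ (-α) * (R * (2 * S ^ (3 / 4 : ℝ) * g * (Real.sqrt e)⁻¹ * f ^ (-(3 / 4 : ℝ)))) :=
            mul_le_mul_of_nonneg_left (mul_le_mul_of_nonneg_left hy34 hR0.le) (by positivity)
        _ = 2 * (g * (e ^ α / Real.sqrt e) * (R * S ^ (3 / 4 : ℝ) * (f ^ (-α) * f ^ (-(3 / 4 : ℝ))))) := by
            rw [div_eq_mul_inv]; ring
        _ = _ := by rw [hEe2]
    have h0 : 0 ≤ g * E * (R * S ^ (3 / 4 : ℝ) * (f ^ (-α) * f ^ (-(3 / 4 : ℝ)))) := by positivity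
    calc e ^ α * f ^ (-α) * (R * y ^ (3 / 4 : ℝ)) * ((2 * D / e) * R * y) ^ ε
        ≤ 2 * (g * E * (R * S ^ (3 / 4 : ℝ) * (f ^ (-α) * f ^ (-(3 / 4 : ℝ))))) * P :=
          mul_le_mul hX hPf' (by positivity) (by positivity)
      _ ≤ 3 * (g * E * (R * S ^ (3 / 4 : ℝ) * (f ^ (-α) * f ^ (-(3 / 4 : ℝ))))) * P := by
          have : 0 ≤ g * E * (R * S ^ (3 / 4 : ℝ) * (f ^ (-α) * f ^ (-(3 / 4 : ℝ)))) * P := by positivity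
          nlinarith
      _ = _ := by ring
  -- term 4
  have hsq4 : Real.sqrt (R * y) = Real.sqrt 2 * Real.sqrt (R * S) * Real.sqrt g / (Real.sqrt e * Real.sqrt f) := by
    rw [hy, show R * (2 * S * g / (e * f)) = 2 * (R * S) * g / (e * f) by ring,
      Real.sqrt_div' _ (by positivity), Real.sqrt_mul' _ hg0.le, Real.sqrt_mul' _ (by positivity),
      Real.sqrt_mul' _ hf0.le]
  have hsqg1 : 1 ≤ Real.sqrt g := by rw [Real.le_sqrt (by norm_num) hg0.le]; simpa using hg
  have hsqg : Real.sqrt g ≤ g := by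
    calc Real.sqrt g ≤ Real.sqrt g * Real.sqrt g := le_mul_of_one_le_right (Real.sqrt_nonneg _) hsqg1
      _ = g := Real.mul_self_sqrt hg0.le
  have h4 : e ^ α * f ^ (-α) * ((2 * D / e) * Real.sqrt (R * y)) * ((2 * D / e) * R * y) ^ ε ≤
      3 * g * E * (D * Real.sqrt (R * S) * (f ^ (-α) * (Real.sqrt f)⁻¹ * f ^ (-ε))) * P := by
    have heq : e ^ α * f ^ (-α) * ((2 * D / e) * Real.sqrt (R * y)) =
        (2 * Real.sqrt 2) * (Real.sqrt g * (e ^ α / (e * Real.sqrt e)) *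
          (D * Real.sqrt (R * S) * (f ^ (-α) * (Real.sqrt f)⁻¹))) := by
      rw [hsq4]; field_simp
    have hX : Real.sqrt g * (e ^ α / (e * Real.sqrt e)) * (D * Real.sqrt (R * S) * (f ^ (-α) * (Real.sqrt f)⁻¹)) ≤
        g * E * (D * Real.sqrt (R * S) * (f ^ (-α) * (Real.sqrt f)⁻¹)) :=
      mul_le_mul_of_nonneg_right (mul_le_mul hsqg hEe3 (by positivity) hg0.le) (by positivity)
    have h0 : 0 ≤ g * E * (D * Real.sqrt (R * S) * (f ^ (-α) * (Real.sqrt f)⁻¹)) := by positivity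
    calc e ^ α * f ^ (-α) * ((2 * D / e) * Real.sqrt (R * y)) * ((2 * D / e) * R * y) ^ ε
        ≤ (2 * Real.sqrt 2) * (g * E * (D * Real.sqrt (R * S) * (f ^ (-α) * (Real.sqrt f)⁻¹))) * (P * f ^ (-ε)) := by
          rw [heq]
          exact mul_le_mul (mul_le_mul_of_nonneg_left hX (by positivity)) hPf (by positivity) (by positivity)
      _ = (2 * Real.sqrt 2) * (g * E * (D * Real.sqrt (R * S) * (f ^ (-α) * (Real.sqrt f)⁻¹ * f ^ (-ε))) * P) := by
          ring
      _ ≤ 3 * (g * E * (D * Real.sqrt (R * S) * (f ^ (-α) * (Real.sqrt f)⁻¹ * f ^ (-ε))) * P) := by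
          have : 0 ≤ g * E * (D * Real.sqrt (R * S) * (f ^ (-α) * (Real.sqrt f)⁻¹ * f ^ (-ε))) * P := by
            positivity
          exact mul_le_mul_of_nonneg_right two_mul_sqrt_two_le_three this
      _ = _ := by ring
  -- combine
  have hsplit : e ^ α * f ^ (-α) * (R * y * Real.sqrt (2 * D / e) / (D / e) +
      (y * R ^ (3 / 4 : ℝ) + R * y ^ (3 / 4 : ℝ) + (2 * D / e) * Real.sqrt (R * y)) * ((2 * D / e) * R * y) ^ ε) =
      e ^ α * f ^ (-α) * (R * y * Real.sqrt (2 * D / e) / (D / e)) +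
      (e ^ α * f ^ (-α) * (y * R ^ (3 / 4 : ℝ)) * ((2 * D / e) * R * y) ^ ε +
       e ^ α * f ^ (-α) * (R * y ^ (3 / 4 : ℝ)) * ((2 * D / e) * R * y) ^ ε +
       e ^ α * f ^ (-α) * ((2 * D / e) * Real.sqrt (R * y)) * ((2 * D / e) * R * y) ^ ε) := by ring
  rw [hsplit]
  have hR : 3 * g * E * (R * S / Real.sqrt D * (f ^ (-α) / f) +
      (S * R ^ (3 / 4 : ℝ) * (f ^ (-α) / f) + R * S ^ (3 / 4 : ℝ) * (f ^ (-α) * f ^ (-(3 / 4 : ℝ))) +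
        D * Real.sqrt (R * S) * (f ^ (-α) * (Real.sqrt f)⁻¹ * f ^ (-ε))) * P) =
      3 * g * E * (R * S / Real.sqrt D * (f ^ (-α) / f)) +
      (3 * g * E * (S * R ^ (3 / 4 : ℝ) * (f ^ (-α) / f)) * P +
       3 * g * E * (R * S ^ (3 / 4 : ℝ) * (f ^ (-α) * f ^ (-(3 / 4 : ℝ)))) * P +
       3 * g * E * (D * Real.sqrt (R * S) * (f ^ (-α) * (Real.sqrt f)⁻¹ * f ^ (-ε))) * P) := by ring
  rw [hR]
  linarith [h1, h2, h3, h4]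




/-! ### W8: assembling (11.19) -/

/-- `f^{-α}/f = f^{-1-α}`. [folklore] -/
theorem rpow_neg_div_self {f : ℝ} (hf : 0 < f) (α : ℝ) : f ^ (-α) / f = f ^ (-1 - α) := by
  rw [div_eq_mul_inv, ← Real.rpow_neg_one, ← Real.rpow_add hf]; congr 1; ring

/-- `f^{-α} f^{-β} = f^{-1-(α+β-1)}`. [folklore] -/
theorem rpow_neg_mul_rpow_neg {f : ℝ} (hf : 0 < f) (α β : ℝ) : f ^ (-α) * f ^ (-β) = f ^ (-1 - (α + β - 1)) := by
  rw [← Real.rpow_add hf]; congr 1; ring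

/-- `f^{-α} (√f)⁻¹ f^{-ε} = f^{-1-(α+ε-1/2)}`. [folklore] -/
theorem rpow_neg_mul_inv_sqrt_mul {f : ℝ} (hf : 0 < f) (α ε : ℝ) :
    f ^ (-α) * (Real.sqrt f)⁻¹ * f ^ (-ε) = f ^ (-1 - (α + ε - 1 / 2)) := by
  rw [Real.sqrt_eq_rpow, ← Real.rpow_neg hf.le, ← Real.rpow_add hf, ← Real.rpow_add hf]; congr 1; ring

/-- `e^α √e / e = e^{α - 1/2}`. [folklore] -/
theorem rpow_mul_sqrt_div {e : ℝ} (he : 0 < e) (α : ℝ) : e ^ α * Real.sqrt e / e = e ^ (α - 1 / 2) := by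
  rw [Real.sqrt_eq_rpow, ← Real.rpow_add he, div_eq_mul_inv, ← Real.rpow_neg_one, ← Real.rpow_add he]
  congr 1; ring

set_option maxHeartbeats 800000 in
/-- **FI (11.19)** (the dual form at level `(D, 2D]`, general `γ`): for `0 < ε ≤ 1/4` there is `C`
with, for all `D, R, S ≥ 1` and all `γ`,
`W(D) ≤ C {RS/√D + (S R^{3/4} + R S^{3/4} + D√(RS)) (4DRS)^ε} ‖γ‖²`
(the removal of the condition `(a, d) = 1`: regroup by `e = (a, d)`, Cauchy with weights
`e^α f^{-α}`, `α = (1-ε)/2`, the pieces bounded by (11.24), and the `f`-series converge).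
[cite: FriedlanderIwaniecAnnals1998, §11, (11.19)] -/
theorem exists_jtW_le_removed {ε : ℝ} (hε : 0 < ε) (hε4 : ε ≤ 1 / 4) :
    ∃ C : ℝ, 0 < C ∧ ∀ (D R S : ℕ) (γ : ℕ → ℕ → ℂ), 1 ≤ D → 1 ≤ R → 1 ≤ S →
      jtW D (2 * D) R S γ ≤ C * ((R : ℝ) * S / Real.sqrt D +
        ((S : ℝ) * (R : ℝ) ^ (3 / 4 : ℝ) + (R : ℝ) * (S : ℝ) ^ (3 / 4 : ℝ) + D * Real.sqrt ((R : ℝ) * S)) *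
          (4 * (D : ℝ) * R * S) ^ ε) * jtNormSq D (2 * D) γ := by
  have hε1 : ε ≤ 1 := by linarith
  set α : ℝ := (1 - ε) / 2 with hα
  have hα0 : 0 < α := by rw [hα]; linarith
  obtain ⟨Cp, hCp0, hCp⟩ := exists_ef_piece_le hε hε1
  obtain ⟨Cτ, hCτ0, hCτ⟩ := exists_sigma_zero_sq_mul_rpow_le (half_pos hε)
  set K₁ : ℝ := 1 + 8 / ε with hK₁
  have hK₁0 : 0 < K₁ := by positivity
  refine ⟨3 * Cp * Cτ * K₁, by positivity, fun D R S γ hD hR hS => ?_⟩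
  set I := Icc 1 (2 * D) with hI
  have hDr : (1 : ℝ) ≤ D := by exact_mod_cast hD
  have hRr : (1 : ℝ) ≤ R := by exact_mod_cast hR
  have hSr : (1 : ℝ) ≤ S := by exact_mod_cast hS
  set P : ℝ := (4 * (D : ℝ) * R * S) ^ ε with hP
  set Br : ℝ := (R : ℝ) * S / Real.sqrt D +
    ((S : ℝ) * (R : ℝ) ^ (3 / 4 : ℝ) + (R : ℝ) * (S : ℝ) ^ (3 / 4 : ℝ) + D * Real.sqrt ((R : ℝ) * S)) * P with hBr
  have hBr0 : 0 ≤ Br := by positivity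
  set N : ℕ → ℝ := fun e => jtNormSq (D / e) (2 * D / e) (jtPull γ e) with hN
  have hN0 : ∀ e, 0 ≤ N e := fun e => jtNormSq_nonneg _ _ _
  -- the four `f`-dependent factors
  set X1 : ℕ → ℝ := fun f => (R : ℝ) * S / Real.sqrt D * ((f : ℝ) ^ (-α) / f) with hX1
  set X2 : ℕ → ℝ := fun f => (S : ℝ) * (R : ℝ) ^ (3 / 4 : ℝ) * ((f : ℝ) ^ (-α) / f) with hX2
  set X3 : ℕ → ℝ := fun f => (R : ℝ) * (S : ℝ) ^ (3 / 4 : ℝ) * ((f : ℝ) ^ (-α) * (f : ℝ) ^ (-(3 / 4 : ℝ))) with hX3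
  set X4 : ℕ → ℝ := fun f => (D : ℝ) * Real.sqrt ((R : ℝ) * S) *
    ((f : ℝ) ^ (-α) * (Real.sqrt (f : ℝ))⁻¹ * (f : ℝ) ^ (-ε)) with hX4
  set Ew : ℕ → ℝ := fun e => (e : ℝ) ^ α * Real.sqrt e / e with hEw
  -- Step 1: each `(e, f)`-term
  have hstep1 : ∀ e ∈ I, ∀ f ∈ I, (e : ℝ) ^ α * (f : ℝ) ^ (-α) *
      ∑ r ∈ Ioc R (2 * R), ∑ s ∈ (Ioc S (2 * S)).filter (fun s => e ∣ s ∧ f ∣ s),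
        ‖jtInner (D / e) (2 * D / e) (jtPull γ e) r (s / e)‖ ^ 2 ≤
      Cp * (3 * (Nat.gcd e f : ℝ) * Ew e * (X1 f + (X2 f + X3 f + X4 f) * P)) * N e := by
    intro e he f hf
    have he1 : 1 ≤ e := (mem_Icc.mp he).1
    have hf1 : 1 ≤ f := (mem_Icc.mp hf).1
    have her : (1 : ℝ) ≤ e := by exact_mod_cast he1
    have hfr : (1 : ℝ) ≤ f := by exact_mod_cast hf1
    have he0 : (0 : ℝ) < e := by linarith
    have hf0 : (0 : ℝ) < f := by linarith
    set g := Nat.gcd e f with hg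
    have hg1 : 1 ≤ g := Nat.gcd_pos_of_pos_left f he1
    have hgr : (1 : ℝ) ≤ g := by exact_mod_cast hg1
    have hge : (g : ℝ) ≤ e := by exact_mod_cast Nat.gcd_le_left f he1
    have hw0 : 0 ≤ (e : ℝ) ^ α * (f : ℝ) ^ (-α) := by positivity
    have hpiece := hCp D R S e f γ hR he1 hf1
    -- the majorant of `jtBnd`
    set y : ℝ := 2 * S * g / (e * f) with hy
    have hlcm : ((Nat.lcm e f : ℕ) : ℝ) = (e : ℝ) * f / g := by
      have h := Nat.gcd_mul_lcm e f
      rw [eq_div_iff (by positivity)]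
      rw [← hg] at h
      have : ((Nat.lcm e f : ℕ) : ℝ) * g = ((g * Nat.lcm e f : ℕ) : ℝ) := by push_cast; ring
      rw [this, h]; push_cast; ring
    have hlcm0 : (0 : ℝ) < (Nat.lcm e f : ℕ) := by exact_mod_cast Nat.lcm_pos he1 hf1
    have hBy : ((2 * S / Nat.lcm e f : ℕ) : ℝ) ≤ y := by
      calc ((2 * S / Nat.lcm e f : ℕ) : ℝ) ≤ ((2 * S : ℕ) : ℝ) / (Nat.lcm e f : ℕ) := Nat.cast_div_le
        _ = y := by rw [hy, hlcm]; push_cast; field_simp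
    have hD₂ : (((2 * D / e : ℕ)) : ℝ) ≤ 2 * (D : ℝ) / e := by
      calc (((2 * D / e : ℕ)) : ℝ) ≤ ((2 * D : ℕ) : ℝ) / (e : ℕ) := Nat.cast_div_le
        _ = _ := by push_cast; ring
    have hδ₁ : (D : ℝ) / e ≤ ((D / e : ℕ) : ℝ) + 1 := by
      have h := Nat.lt_div_mul_add (a := D) (show 0 < e from he1)
      have h' : (D : ℝ) < ((D / e : ℕ) : ℝ) * e + e := by exact_mod_cast h
      rw [div_le_iff₀ he0]
      nlinarith
    have hmaj := jtBnd_le_of_le (ε := ε) hε.le (D₁ := D / e) (D₂ := 2 * D / e) (R := R) (Nat.cast_nonneg _) hBy hD₂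
      (by positivity : (0 : ℝ) < (D : ℝ) / e) hδ₁
    have halg := ef_weights_le (α := α) hε hDr hRr hSr her hfr hgr hge
    calc (e : ℝ) ^ α * (f : ℝ) ^ (-α) * ∑ r ∈ Ioc R (2 * R),
          ∑ s ∈ (Ioc S (2 * S)).filter (fun s => e ∣ s ∧ f ∣ s),
            ‖jtInner (D / e) (2 * D / e) (jtPull γ e) r (s / e)‖ ^ 2
        ≤ (e : ℝ) ^ α * (f : ℝ) ^ (-α) *
            (Cp * jtBnd ε (D / e) (2 * D / e) R ((2 * S / Nat.lcm e f : ℕ) : ℝ) * N e) :=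
          mul_le_mul_of_nonneg_left hpiece hw0
      _ ≤ (e : ℝ) ^ α * (f : ℝ) ^ (-α) * (Cp * ((R : ℝ) * y * Real.sqrt (2 * D / e) / (D / e) +
            (y * (R : ℝ) ^ (3 / 4 : ℝ) + (R : ℝ) * y ^ (3 / 4 : ℝ) + (2 * D / e) * Real.sqrt ((R : ℝ) * y)) *
              ((2 * D / e) * R * y) ^ ε) * N e) := by
          refine mul_le_mul_of_nonneg_left (mul_le_mul_of_nonneg_right
            (mul_le_mul_of_nonneg_left hmaj hCp0.le) (hN0 e)) hw0
      _ = Cp * ((e : ℝ) ^ α * (f : ℝ) ^ (-α) * ((R : ℝ) * y * Real.sqrt (2 * D / e) / (D / e) +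
            (y * (R : ℝ) ^ (3 / 4 : ℝ) + (R : ℝ) * y ^ (3 / 4 : ℝ) + (2 * D / e) * Real.sqrt ((R : ℝ) * y)) *
              ((2 * D / e) * R * y) ^ ε)) * N e := by ring
      _ ≤ Cp * (3 * (g : ℝ) * Ew e * (X1 f + (X2 f + X3 f + X4 f) * P)) * N e := by
          refine mul_le_mul_of_nonneg_right (mul_le_mul_of_nonneg_left ?_ hCp0.le) (hN0 e)
          exact halg
  -- Step 2: the `f`-sums for fixed `e`
  have hK1 : 1 + 1 / α ≤ K₁ := by
    rw [hK₁, hα]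
    have : 1 / ((1 - ε) / 2) ≤ 8 / ε := by
      rw [div_le_div_iff₀ (by linarith) hε]; nlinarith
    linarith
  have hκ3 : 0 < α + 3 / 4 - 1 := by rw [hα]; linarith
  have hK3 : 1 + 1 / (α + 3 / 4 - 1) ≤ K₁ := by
    rw [hK₁, hα]
    have : 1 / ((1 - ε) / 2 + 3 / 4 - 1) ≤ 8 / ε := by
      rw [div_le_div_iff₀ (by linarith) hε]; nlinarith
    linarith
  have hκ4 : 0 < α + ε - 1 / 2 := by rw [hα]; linarith
  have hK4 : 1 + 1 / (α + ε - 1 / 2) ≤ K₁ := by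
    rw [hK₁, hα]
    have : 1 / ((1 - ε) / 2 + ε - 1 / 2) ≤ 8 / ε := by
      rw [div_le_div_iff₀ (by linarith) hε]; nlinarith
    linarith
  have hstep2 : ∀ e ∈ I, ∑ f ∈ I, (Nat.gcd e f : ℝ) * (X1 f + (X2 f + X3 f + X4 f) * P) ≤
      (σ 0 e : ℝ) * K₁ * Br := by
    intro e he
    have he1 : 0 < e := (mem_Icc.mp he).1
    have hσ0 : (0 : ℝ) ≤ (σ 0 e : ℝ) := Nat.cast_nonneg _
    -- the four sums
    have hs1 := sum_gcd_rpow_mul_rpow_le (2 * D) he1 (θ := 1) hα0 (by linarith)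
    have hs3 := sum_gcd_rpow_mul_rpow_le (2 * D) he1 (θ := 1) hκ3 (by linarith)
    have hs4 := sum_gcd_rpow_mul_rpow_le (2 * D) he1 (θ := 1) hκ4 (by linarith)
    have hsum_eq : ∑ f ∈ I, (Nat.gcd e f : ℝ) * (X1 f + (X2 f + X3 f + X4 f) * P) =
        (R : ℝ) * S / Real.sqrt D * ∑ f ∈ I, ((Nat.gcd e f : ℕ) : ℝ) ^ (1 : ℝ) * (f : ℝ) ^ (-1 - α) +
        ((S : ℝ) * (R : ℝ) ^ (3 / 4 : ℝ) * ∑ f ∈ I, ((Nat.gcd e f : ℕ) : ℝ) ^ (1 : ℝ) * (f : ℝ) ^ (-1 - α) +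
          (R : ℝ) * (S : ℝ) ^ (3 / 4 : ℝ) * ∑ f ∈ I, ((Nat.gcd e f : ℕ) : ℝ) ^ (1 : ℝ) * (f : ℝ) ^ (-1 - (α + 3 / 4 - 1)) +
          (D : ℝ) * Real.sqrt ((R : ℝ) * S) *
            ∑ f ∈ I, ((Nat.gcd e f : ℕ) : ℝ) ^ (1 : ℝ) * (f : ℝ) ^ (-1 - (α + ε - 1 / 2))) * P := by
      rw [mul_sum, mul_sum, mul_sum, mul_sum, ← sum_add_distrib, ← sum_add_distrib, sum_mul, ← sum_add_distrib]
      refine sum_congr rfl fun f hf => ?_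
      have hf0 : (0 : ℝ) < f := by exact_mod_cast (mem_Icc.mp hf).1
      rw [hX1, hX2, hX3, hX4]; dsimp only
      rw [rpow_neg_div_self hf0, rpow_neg_mul_rpow_neg hf0, rpow_neg_mul_inv_sqrt_mul hf0, Real.rpow_one]
      ring
    rw [hsum_eq]
    have hB1 : 0 ≤ (R : ℝ) * S / Real.sqrt D := by positivity
    have hB2 : 0 ≤ (S : ℝ) * (R : ℝ) ^ (3 / 4 : ℝ) := by positivity
    have hB3 : 0 ≤ (R : ℝ) * (S : ℝ) ^ (3 / 4 : ℝ) := by positivity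
    have hB4 : 0 ≤ (D : ℝ) * Real.sqrt ((R : ℝ) * S) := by positivity
    have hP0 : 0 ≤ P := by positivity
    have e1 : ∑ f ∈ I, ((Nat.gcd e f : ℕ) : ℝ) ^ (1 : ℝ) * (f : ℝ) ^ (-1 - α) ≤ (σ 0 e : ℝ) * K₁ :=
      hs1.trans (mul_le_mul_of_nonneg_left hK1 hσ0)
    have e3 : ∑ f ∈ I, ((Nat.gcd e f : ℕ) : ℝ) ^ (1 : ℝ) * (f : ℝ) ^ (-1 - (α + 3 / 4 - 1)) ≤ (σ 0 e : ℝ) * K₁ :=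
      hs3.trans (mul_le_mul_of_nonneg_left hK3 hσ0)
    have e4 : ∑ f ∈ I, ((Nat.gcd e f : ℕ) : ℝ) ^ (1 : ℝ) * (f : ℝ) ^ (-1 - (α + ε - 1 / 2)) ≤ (σ 0 e : ℝ) * K₁ :=
      hs4.trans (mul_le_mul_of_nonneg_left hK4 hσ0)
    have hBr' : (σ 0 e : ℝ) * K₁ * Br = (R : ℝ) * S / Real.sqrt D * ((σ 0 e : ℝ) * K₁) +
        ((S : ℝ) * (R : ℝ) ^ (3 / 4 : ℝ) * ((σ 0 e : ℝ) * K₁) + (R : ℝ) * (S : ℝ) ^ (3 / 4 : ℝ) * ((σ 0 e : ℝ) * K₁) +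
          (D : ℝ) * Real.sqrt ((R : ℝ) * S) * ((σ 0 e : ℝ) * K₁)) * P := by rw [hBr]; ring
    rw [hBr']
    have i1 := mul_le_mul_of_nonneg_left e1 hB1
    have i2 := mul_le_mul_of_nonneg_left e1 hB2
    have i3 := mul_le_mul_of_nonneg_left e3 hB3
    have i4 := mul_le_mul_of_nonneg_left e4 hB4
    have i5 := mul_le_mul_of_nonneg_right (add_le_add (add_le_add i2 i3) i4) hP0
    linarith
  -- Step 3: the `e`-factors
  have hstep3 : ∀ e ∈ I, Ew e * (σ 0 e : ℝ) ≤ Cτ := by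
    intro e he
    have he1 : 1 ≤ e := (mem_Icc.mp he).1
    have he0 : (0 : ℝ) < e := by exact_mod_cast he1
    have hEw' : Ew e = (e : ℝ) ^ (-(ε / 2)) := by
      rw [hEw]; dsimp only; rw [rpow_mul_sqrt_div he0, hα]; congr 1; ring
    have hσ1 : (1 : ℝ) ≤ (σ 0 e : ℝ) := by
      have : 0 < σ 0 e := by
        rw [ArithmeticFunction.sigma_zero_apply]; exact Finset.card_pos.mpr ⟨1, Nat.one_mem_divisors.mpr (by omega)⟩
      exact_mod_cast this
    have h := hCτ e he1
    calc Ew e * (σ 0 e : ℝ) = (σ 0 e : ℝ) * (e : ℝ) ^ (-(ε / 2)) := by rw [hEw', mul_comm]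
      _ ≤ (σ 0 e : ℝ) ^ 2 * (e : ℝ) ^ (-(ε / 2)) := by
          refine mul_le_mul_of_nonneg_right ?_ (by positivity)
          calc (σ 0 e : ℝ) = (σ 0 e : ℝ) * 1 := (mul_one _).symm
            _ ≤ (σ 0 e : ℝ) * (σ 0 e : ℝ) := mul_le_mul_of_nonneg_left hσ1 (by positivity)
            _ = (σ 0 e : ℝ) ^ 2 := (sq _).symm
      _ ≤ Cτ := h
  -- Step 4: assemble
  have hEw0 : ∀ e, 0 ≤ Ew e := fun e => by rw [hEw]; positivity
  calc jtW D (2 * D) R S γ ≤ _ := jtW_le_sum_pairs_ef D R S γ α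
    _ ≤ ∑ e ∈ I, ∑ f ∈ I, Cp * (3 * (Nat.gcd e f : ℝ) * Ew e * (X1 f + (X2 f + X3 f + X4 f) * P)) * N e :=
        sum_le_sum fun e he => sum_le_sum fun f hf => hstep1 e he f hf
    _ = ∑ e ∈ I, 3 * Cp * Ew e * N e * ∑ f ∈ I, (Nat.gcd e f : ℝ) * (X1 f + (X2 f + X3 f + X4 f) * P) := by
        refine sum_congr rfl fun e _ => ?_
        rw [mul_sum]
        refine sum_congr rfl fun f _ => ?_
        ring
    _ ≤ ∑ e ∈ I, 3 * Cp * Ew e * N e * ((σ 0 e : ℝ) * K₁ * Br) :=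
        sum_le_sum fun e he => mul_le_mul_of_nonneg_left (hstep2 e he)
          (mul_nonneg (mul_nonneg (by positivity) (hEw0 e)) (hN0 e))
    _ = ∑ e ∈ I, 3 * Cp * K₁ * Br * (Ew e * (σ 0 e : ℝ)) * N e := sum_congr rfl fun e _ => by ring
    _ ≤ ∑ e ∈ I, 3 * Cp * K₁ * Br * Cτ * N e :=
        sum_le_sum fun e he => mul_le_mul_of_nonneg_right
          (mul_le_mul_of_nonneg_left (hstep3 e he) (by positivity)) (hN0 e)
    _ = 3 * Cp * Cτ * K₁ * Br * ∑ e ∈ I, N e := by rw [mul_sum]; refine sum_congr rfl fun e _ => ?_; ring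
    _ ≤ 3 * Cp * Cτ * K₁ * Br * jtNormSq D (2 * D) γ :=
        mul_le_mul_of_nonneg_left (sum_jtNormSq_jtPull_le D (2 * D) γ) (by positivity)
    _ = _ := by rw [hBr]




/-! ### Proposition 11.1 -/

/-- **FI Proposition 11.1.** For any `ε > 0` there is `C = C(ε)` such that for all `D, R, S ≥ 1`
and all complex `α_{rs}` (`R < r ≤ 2R`, `S < s ≤ 2S`):
`∑_{D<d≤2D} ∑_{a mod d} |∑_{(r,d)=1} ∑_{s ≡ a r (d)} α_{rs} (r/d')|²
   ≤ C {D^{-1/2} RS + (D√(RS) + R S^{3/4} + S R^{3/4})(RS)^ε} ∑ |α_{rs}|²`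
(here `d'` is the odd part of `d` and `(r/d')` the Jacobi symbol; `jtV`). Proof: for `D ≤ 4RS`
by duality from (11.19) (`exists_jtW_le_removed`, with `(4DRS)^{ε'} ≤ 16 (RS)^ε`); for
`D > 4RS` directly (`jtV_le_of_large_level`: `V ≤ D min(R,S) ‖α‖² ≤ D√(RS) ‖α‖²`).
[cite: FriedlanderIwaniecAnnals1998, Proposition 11.1, (11.14)] -/
theorem exists_jtV_le {ε : ℝ} (hε : 0 < ε) :
    ∃ C : ℝ, 0 < C ∧ ∀ (D R S : ℕ) (α : ℕ → ℕ → ℂ), 1 ≤ D → 1 ≤ R → 1 ≤ S →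
      jtV D (2 * D) R S α ≤ C * ((R : ℝ) * S / Real.sqrt D +
        ((D : ℝ) * Real.sqrt ((R : ℝ) * S) + (R : ℝ) * (S : ℝ) ^ (3 / 4 : ℝ) + (S : ℝ) * (R : ℝ) ^ (3 / 4 : ℝ)) *
          ((R : ℝ) * S) ^ ε) * ∑ r ∈ Ioc R (2 * R), ∑ s ∈ Ioc S (2 * S), ‖α r s‖ ^ 2 := by
  set ε₀ : ℝ := min ε (1 / 4) / 2 with hε₀
  have hε₀0 : 0 < ε₀ := by rw [hε₀]; exact half_pos (lt_min hε (by norm_num))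
  have hε₀4 : ε₀ ≤ 1 / 4 := by
    rw [hε₀]; have := min_le_right ε (1 / 4); linarith
  have hε₀ε : 2 * ε₀ ≤ ε := by rw [hε₀]; have := min_le_left ε (1 / 4); linarith
  obtain ⟨C₀, hC₀0, hC₀⟩ := exists_jtW_le_removed hε₀0 hε₀4
  refine ⟨16 * C₀ + 1, by positivity, fun D R S α hD hR hS => ?_⟩
  have hDr : (1 : ℝ) ≤ D := by exact_mod_cast hD
  have hRr : (1 : ℝ) ≤ R := by exact_mod_cast hR
  have hSr : (1 : ℝ) ≤ S := by exact_mod_cast hS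
  have hRS1 : (1 : ℝ) ≤ (R : ℝ) * S := by nlinarith
  set N2 : ℝ := ∑ r ∈ Ioc R (2 * R), ∑ s ∈ Ioc S (2 * S), ‖α r s‖ ^ 2 with hN2
  have hN20 : 0 ≤ N2 := sum_nonneg fun _ _ => sum_nonneg fun _ _ => by positivity
  set T : ℝ := (D : ℝ) * Real.sqrt ((R : ℝ) * S) + (R : ℝ) * (S : ℝ) ^ (3 / 4 : ℝ) + (S : ℝ) * (R : ℝ) ^ (3 / 4 : ℝ)
    with hT
  have hT0 : 0 ≤ T := by positivity
  have hPε : 1 ≤ ((R : ℝ) * S) ^ ε := Real.one_le_rpow hRS1 hε.le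
  have hA0 : 0 ≤ (R : ℝ) * S / Real.sqrt D := by positivity
  rcases le_or_gt D (4 * R * S) with hsmall | hlarge
  · -- `D ≤ 4RS`: duality from (11.19)
    have hW : ∀ γ : ℕ → ℕ → ℂ, jtW D (2 * D) R S γ ≤ (C₀ * ((R : ℝ) * S / Real.sqrt D +
        ((S : ℝ) * (R : ℝ) ^ (3 / 4 : ℝ) + (R : ℝ) * (S : ℝ) ^ (3 / 4 : ℝ) + D * Real.sqrt ((R : ℝ) * S)) *
          (4 * (D : ℝ) * R * S) ^ ε₀)) * jtNormSq D (2 * D) γ := fun γ => hC₀ D R S γ hD hR hS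
    have hΔ0 : 0 ≤ C₀ * ((R : ℝ) * S / Real.sqrt D +
        ((S : ℝ) * (R : ℝ) ^ (3 / 4 : ℝ) + (R : ℝ) * (S : ℝ) ^ (3 / 4 : ℝ) + D * Real.sqrt ((R : ℝ) * S)) *
          (4 * (D : ℝ) * R * S) ^ ε₀) := by positivity
    have hV := jtV_le_of_forall_jtW_le hΔ0 hW α
    -- `(4DRS)^{ε₀} ≤ 16 (RS)^ε`
    have hpow : (4 * (D : ℝ) * R * S) ^ ε₀ ≤ 16 * ((R : ℝ) * S) ^ ε := by
      have hsm : (D : ℝ) ≤ 4 * R * S := by exact_mod_cast hsmall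
      have h1 : 4 * (D : ℝ) * R * S ≤ 16 * ((R : ℝ) * S) ^ 2 := by nlinarith
      calc (4 * (D : ℝ) * R * S) ^ ε₀ ≤ (16 * ((R : ℝ) * S) ^ 2) ^ ε₀ :=
            Real.rpow_le_rpow (by positivity) h1 hε₀0.le
        _ = (16 : ℝ) ^ ε₀ * ((R : ℝ) * S) ^ (2 * ε₀) := by
            rw [Real.mul_rpow (by norm_num) (by positivity), ← Real.rpow_natCast, ← Real.rpow_mul (by positivity)]
            norm_num
        _ ≤ 16 * ((R : ℝ) * S) ^ ε := by
            refine mul_le_mul ?_ (Real.rpow_le_rpow_of_exponent_le hRS1 hε₀ε) (by positivity) (by norm_num)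
            calc (16 : ℝ) ^ ε₀ ≤ (16 : ℝ) ^ (1 : ℝ) := Real.rpow_le_rpow_of_exponent_le (by norm_num) (by linarith)
              _ = 16 := Real.rpow_one 16
    have hTeq : (S : ℝ) * (R : ℝ) ^ (3 / 4 : ℝ) + (R : ℝ) * (S : ℝ) ^ (3 / 4 : ℝ) + D * Real.sqrt ((R : ℝ) * S) = T := by
      rw [hT]; ring
    rw [hTeq] at hV
    calc jtV D (2 * D) R S α ≤ C₀ * ((R : ℝ) * S / Real.sqrt D + T * (4 * (D : ℝ) * R * S) ^ ε₀) * N2 := hV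
      _ ≤ C₀ * ((R : ℝ) * S / Real.sqrt D + T * (16 * ((R : ℝ) * S) ^ ε)) * N2 := by
          refine mul_le_mul_of_nonneg_right (mul_le_mul_of_nonneg_left ?_ hC₀0.le) hN20
          exact add_le_add le_rfl (mul_le_mul_of_nonneg_left hpow hT0)
      _ ≤ (16 * C₀ + 1) * ((R : ℝ) * S / Real.sqrt D + T * ((R : ℝ) * S) ^ ε) * N2 := by
          refine mul_le_mul_of_nonneg_right ?_ hN20
          have h1 : 0 ≤ T * ((R : ℝ) * S) ^ ε := by positivity
          nlinarith [mul_nonneg hC₀0.le hA0, mul_nonneg hC₀0.le h1]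
  · -- `D > 4RS`: directly
    have h4 : 4 * R * S ≤ D := hlarge.le
    have hV := jtV_le_of_large_level (D₂ := 2 * D) h4 α
    have hmin : min (R : ℝ) S ≤ Real.sqrt ((R : ℝ) * S) := by
      have hR0 : (0 : ℝ) ≤ R := by linarith
      have hS0 : (0 : ℝ) ≤ S := by linarith
      rw [Real.le_sqrt (le_min hR0 hS0) (mul_nonneg hR0 hS0), sq]
      rcases le_total (R : ℝ) S with h | h
      · rw [min_eq_left h]; exact mul_le_mul_of_nonneg_left h hR0
      · rw [min_eq_right h]; exact mul_le_mul_of_nonneg_right h hS0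
    have hcard : ((2 * D - D : ℕ) : ℝ) = D := by
      have : 2 * D - D = D := by omega
      rw [this]
    rw [hcard] at hV
    calc jtV D (2 * D) R S α ≤ (D : ℝ) * min (R : ℝ) S * N2 := hV
      _ ≤ (D : ℝ) * Real.sqrt ((R : ℝ) * S) * N2 :=
          mul_le_mul_of_nonneg_right (mul_le_mul_of_nonneg_left hmin (by linarith)) hN20
      _ ≤ 1 * ((R : ℝ) * S / Real.sqrt D + T * ((R : ℝ) * S) ^ ε) * N2 := by
          refine mul_le_mul_of_nonneg_right ?_ hN20
          rw [one_mul]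
          have h1 : (D : ℝ) * Real.sqrt ((R : ℝ) * S) ≤ T := by
            rw [hT]
            have : 0 ≤ (R : ℝ) * (S : ℝ) ^ (3 / 4 : ℝ) + (S : ℝ) * (R : ℝ) ^ (3 / 4 : ℝ) := by positivity
            linarith
          calc (D : ℝ) * Real.sqrt ((R : ℝ) * S) ≤ T := h1
            _ = T * 1 := (mul_one _).symm
            _ ≤ T * ((R : ℝ) * S) ^ ε := mul_le_mul_of_nonneg_left hPε hT0
            _ ≤ _ := by linarith
      _ ≤ (16 * C₀ + 1) * ((R : ℝ) * S / Real.sqrt D + T * ((R : ℝ) * S) ^ ε) * N2 := by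
          refine mul_le_mul_of_nonneg_right (mul_le_mul_of_nonneg_right (by linarith) ?_) hN20
          positivity


end Literature.NumberTheory.Sieve.FriedlanderIwaniecPrimes
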